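import Literature.MathematicalPhysics.QuantumFieldTheory.Balaban1983to89.B6BlockDecayLapCompositesV1
import Literature.MathematicalPhysics.QuantumFieldTheory.Balaban1983to89.B6L2Block114GEV1

/-!
# `Balaban1983to89.B6L2BlockSmoothTermsV1` — T. Bałaban, *Propagators and renormalization transformations for lattice gauge theories. II*,
# Commun. Math. Phys. **96** (1984) 223–250 [Balaban1984PropagatorsII], PROPOSITION 2.5 p. 246, the SMOOTH factors of `∇_λ∇_μG` for the two-scale
# `G` of (2.90) in `ℓ²`-BLOCK form: `M = G̃_j + H_jC̃^{(j)}_ΛH_j*`, `K₂`, and the right factor `R₀ = I − Q_j*(Δ_j + w′)Q_jG^{(w′)} + Q_j*(Δ_j + w′)C̃H_j*`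
# of `M = G^{(w′)}R₀` — uniform row and column block bounds at `c = L^j` and (Schur on blocks, file 23) uniform `ℓ²`-block bounds (file 25b of the
# unit's `ℓ²` programme for the two-derivative members of (1.114))

statement-level skeleton of published theorems with citation tags; proofs where landed; nothing here is a claim about the Yang–Mills mass gap

p. 246 (verbatim): *"From these representations we obtain all the necessary properties of the operators H_j, G̃_j. They follow from the Proposition
1.2 … The operator G … has the representation (2.129) and satisfies all the inequalities (1.110)–(1.114) of the Proposition 1.2 with a positive
constant δ₂ instead of δ₀."*  [4] (1.114) p. 36: *"… ‖ζ∇G∇*J‖, ‖ζ∇∇GJ‖, ‖ζG∇*∇*J‖ ≤ O(1)e^{−δ₀|y−y′|}|ζ|‖J‖ …"*.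

CITATION HEADER (lean-in-tree rule) — WHAT IS REPRODUCED.  Phase-2 file of the `lit-balaban` typed skeleton (HOME `run/shared/lean/pub/lit-balaban/`),
seat **p22 gen 16**, lane B6 §C (fold owner r03, referee ref-4); SKELETON rows **B6.Prop2.5** / **B6.Eq2.129-2.131** (cells only).  With
`H_j = G^{(w′)}Q_j*(Δ_j + w′)` (file 20) and `G̃_j = (I − H_jQ_j)G^{(w′)}` (file 6), `M := G̃_j + H_jC̃H_j* = G^{(w′)}·R₀` (`M_eq_GE_comp_R0`), so that
`∇_λ∇_μM(I − K₂) = (∇_λ∇_μG^{(w′)})·R₀(I − K₂)` has the singular factor of file 24 on the left and smooth factors on the right.  §0 same-rate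
compositions of block bounds (`blockBound_comp2r/3r/4r`, file 2's `blockBound_comp`); §1 the adjoints (`adjoint_Gt_V1`, `adjoint_Ct_V1`,
`adjoint_Δj_V1`, `adjoint_M_V1`, `adjoint_R0_eq`: the tree's `Gt_symm`, `Ct_symm`, `Δj_symm`, `M_symm`, file 24's `adjoint_GEW`) and
`M_eq_GE_comp_R0`; §2 `M` and `K₂`: rows (files 6, 5, 3) ⇒ **`l2blk_M_scaling`**, **`l2blk_K2_scaling`**; §3 the four products
`Q_j*(Δ_j + w′)Q_jG^{(w′)}`, `Q_j*(Δ_j + w′)C̃H_j*` and their adjoints — row block bounds uniform at the scaling (`Q_j*` `(n^{−(d+1)}e^{δ}, δ)` file 20,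
`Δ_j + w′` `(n^{d+1}(A_Δ(d+1) + 1), κ_Δ)` file 20, `Q_j` `(e^{δ}, δ)` file 6, `G^{(w′)}` file 6, `C̃` `(E/n^{d+1}, δ_C)` file 8, `H_j`, `H_j*` file 5:
every power of `n` cancels); §4 **`l2blk_R0_scaling`**: the `ℓ²`-block bound of `R₀`, uniform (`∃ δ > 0, C ≥ 0` on `d, L, a₀, a₁`; weights
`a₀n^{d+1} ≤ w ≤ a₁n^{d+1}`, `w′ = n^{d+1}`).  IMPORTS BY NAME, restating nothing.  THEOREMS ONLY; standard axioms.  HONEST SCOPE: bookkeeping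
of (2.129)–(2.131) at the scaling; the assembly of `∇_λ∇_μG` is the sequel file; constants ours and crude; NOT summit progress.
Unit `lit-balaban-p22` (gen 16), 2026-08-22.
-/

noncomputable section

open scoped InnerProductSpace BigOperators Matrix
open Finset

namespace Literature.MathematicalPhysics.QuantumFieldTheory.Balaban1983to89.B6L2BlockSmoothTermsV1

open LatticeFieldCalculus B5SectBStatements B5Eq117TorusCarriers B6SectADomainsV1 B6SectAOperatorsV1 B6SectAVectorModelV1 B6SectCOperators
  B6SectCTwoScaleV1 B6SectCTwoScaleV1Lattice B5Eq118OneStroke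
open BalabanImbrieJaffe1984to88.BIJ85AxialPropagator411 (BondSpace)
open B4Sect5Torus (IsPseudoDist SumBound)
open B4TorusKernel (periodConst)
open B4TorusKernel.MultiPeriod (torusSupNorm torusSupNorm_nonneg)
open B4Sect5Proof (latticeConst latticeConst_nonneg)
open B5Kernel166Decay (periodConst_pos)
open B5Symbol166Strip (kappa166 kappa166_pos)
open B5Hk163Decay (MG163 MG163_nonneg)
open B5Hk163Strip (kappa163 kappa163_pos)
open B12Eq443LatticeMoments (MC)
open B6LowerBound2153Torus (rep)
open B6Repr2129Operator (M_symm Gt_symm Ct_symm)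
open B6SectCPositivity (Δj_symm)
open B6BlockDecayCalculus (blockBound_comp blockBound_add blockBound_sub blockBound_smul blockBound_id blockBound_mono torusDist_isPseudoDist
  torusDist_sumBound)
open B6BlockDecayK12V1 (blockBound_K2_scaling blockBound_K2adj_scaling)
open B6BlockDecayHjCovV1 (blockBound_Hj blockBound_Hj_adjoint blockBound_HjCtHj_scaling)
open B6BlockDecayGtV1 (Gt_eq_comp_GE blockBound_GE_scaling blockBound_Qv blockBound_Gt_scaling)
open B6BlockDecayGradFactorsV1 (blockBound_Ct_scaling)
open B6BlockDecayLapHjV1 (Hj_eq_GE_comp_V1 blockBound_Qv_adjoint blockBound_Δj ADelta_nonneg)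
open B6L2BlockCalculus (l2blk_of_blockBounds)
open B6L2Block114GEV1 (adjoint_GEW)

/-! ## §0  Same-rate compositions of block bounds (file 2's `blockBound_comp`, rates halved) -/

section Abstract

variable {Y : Type*} {ρ : Y → Y → ℝ} {KY : ℝ → ℝ}
variable {ι₀ ι₁ ι₂ ι₃ ι₄ : Type} [Fintype ι₁] [DecidableEq ι₁] [Fintype ι₂] [DecidableEq ι₂] [Fintype ι₃] [DecidableEq ι₃]
  [Fintype ι₄] [DecidableEq ι₄]

omit [Fintype ι₃] [DecidableEq ι₃] [Fintype ι₄] [DecidableEq ι₄] in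
/-- two block bounds at the same rate `a` compose at rate `a/2`. [cite: Balaban1984PropagatorsI, (1.110) p.35 (bookkeeping, ours)] -/
theorem blockBound_comp2r [Fintype Y] [DecidableEq Y] (hρ : IsPseudoDist ρ) (hK : SumBound ρ KY)
    (f : EuclideanSpace ℝ ι₁ →ₗ[ℝ] EuclideanSpace ℝ ι₀) (g : EuclideanSpace ℝ ι₂ →ₗ[ℝ] EuclideanSpace ℝ ι₁)
    (p₀ : ι₀ → Y) (p₁ : ι₁ → Y) (p₂ : ι₂ → Y) {Cf Cg a : ℝ} (hCf : 0 ≤ Cf) (hCg : 0 ≤ Cg) (ha : 0 < a)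
    (hf : ∀ (i : ι₀) (y : Y), ∑ k ∈ univ.filter (fun k => p₁ k = y), |f (EuclideanSpace.single k (1 : ℝ)) i| ≤ Cf * Real.exp (-(a * ρ (p₀ i) y)))
    (hg : ∀ (i : ι₁) (y : Y), ∑ k ∈ univ.filter (fun k => p₂ k = y), |g (EuclideanSpace.single k (1 : ℝ)) i| ≤ Cg * Real.exp (-(a * ρ (p₁ i) y)))
    (i : ι₀) (y : Y) :
    ∑ k ∈ univ.filter (fun k => p₂ k = y), |(f ∘ₗ g) (EuclideanSpace.single k (1 : ℝ)) i| ≤ Cf * Cg * KY (a - a / 2) * Real.exp (-(a / 2 * ρ (p₀ i) y)) :=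
  blockBound_comp hρ hK f g p₀ p₁ p₂ hCf hCg (by positivity) (by linarith) (by linarith) hf hg i y

omit [Fintype ι₄] [DecidableEq ι₄] in
/-- three block bounds at the same rate `a` compose at rate `a/4`. [cite: Balaban1984PropagatorsI, (1.110) p.35 (bookkeeping, ours)] -/
theorem blockBound_comp3r [Fintype Y] [DecidableEq Y] (hρ : IsPseudoDist ρ) (hK : SumBound ρ KY)
    (f : EuclideanSpace ℝ ι₁ →ₗ[ℝ] EuclideanSpace ℝ ι₀) (g : EuclideanSpace ℝ ι₂ →ₗ[ℝ] EuclideanSpace ℝ ι₁) (h : EuclideanSpace ℝ ι₃ →ₗ[ℝ] EuclideanSpace ℝ ι₂)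
    (p₀ : ι₀ → Y) (p₁ : ι₁ → Y) (p₂ : ι₂ → Y) (p₃ : ι₃ → Y) {Cf Cg Ch a : ℝ} (hCf : 0 ≤ Cf) (hCg : 0 ≤ Cg) (hCh : 0 ≤ Ch) (ha : 0 < a)
    (hKY : ∀ t : ℝ, 0 < t → 0 ≤ KY t)
    (hf : ∀ (i : ι₀) (y : Y), ∑ k ∈ univ.filter (fun k => p₁ k = y), |f (EuclideanSpace.single k (1 : ℝ)) i| ≤ Cf * Real.exp (-(a * ρ (p₀ i) y)))
    (hg : ∀ (i : ι₁) (y : Y), ∑ k ∈ univ.filter (fun k => p₂ k = y), |g (EuclideanSpace.single k (1 : ℝ)) i| ≤ Cg * Real.exp (-(a * ρ (p₁ i) y)))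
    (hh : ∀ (i : ι₂) (y : Y), ∑ k ∈ univ.filter (fun k => p₃ k = y), |h (EuclideanSpace.single k (1 : ℝ)) i| ≤ Ch * Real.exp (-(a * ρ (p₂ i) y)))
    (i : ι₀) (y : Y) :
    ∑ k ∈ univ.filter (fun k => p₃ k = y), |(f ∘ₗ g ∘ₗ h) (EuclideanSpace.single k (1 : ℝ)) i| ≤
      Cf * (Cg * Ch * KY (a - a / 2)) * KY (a - a / 4) * Real.exp (-(a / 4 * ρ (p₀ i) y)) := by
  have h1 := blockBound_comp2r hρ hK g h p₁ p₂ p₃ hCg hCh ha hg hh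
  exact blockBound_comp hρ hK f (g ∘ₗ h) p₀ p₁ p₃ hCf (mul_nonneg (mul_nonneg hCg hCh) (hKY _ (by linarith))) (by positivity)
    (by linarith) (by linarith) hf h1 i y

/-- four block bounds at the same rate `a` compose at rate `a/8`. [cite: Balaban1984PropagatorsI, (1.110) p.35 (bookkeeping, ours)] -/
theorem blockBound_comp4r [Fintype Y] [DecidableEq Y] (hρ : IsPseudoDist ρ) (hK : SumBound ρ KY)
    (f : EuclideanSpace ℝ ι₁ →ₗ[ℝ] EuclideanSpace ℝ ι₀) (g : EuclideanSpace ℝ ι₂ →ₗ[ℝ] EuclideanSpace ℝ ι₁) (h : EuclideanSpace ℝ ι₃ →ₗ[ℝ] EuclideanSpace ℝ ι₂)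
    (k : EuclideanSpace ℝ ι₄ →ₗ[ℝ] EuclideanSpace ℝ ι₃)
    (p₀ : ι₀ → Y) (p₁ : ι₁ → Y) (p₂ : ι₂ → Y) (p₃ : ι₃ → Y) (p₄ : ι₄ → Y) {Cf Cg Ch Ck a : ℝ} (hCf : 0 ≤ Cf) (hCg : 0 ≤ Cg) (hCh : 0 ≤ Ch)
    (hCk : 0 ≤ Ck) (ha : 0 < a) (hKY : ∀ t : ℝ, 0 < t → 0 ≤ KY t)
    (hf : ∀ (i : ι₀) (y : Y), ∑ k ∈ univ.filter (fun k => p₁ k = y), |f (EuclideanSpace.single k (1 : ℝ)) i| ≤ Cf * Real.exp (-(a * ρ (p₀ i) y)))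
    (hg : ∀ (i : ι₁) (y : Y), ∑ k ∈ univ.filter (fun k => p₂ k = y), |g (EuclideanSpace.single k (1 : ℝ)) i| ≤ Cg * Real.exp (-(a * ρ (p₁ i) y)))
    (hh : ∀ (i : ι₂) (y : Y), ∑ k ∈ univ.filter (fun k => p₃ k = y), |h (EuclideanSpace.single k (1 : ℝ)) i| ≤ Ch * Real.exp (-(a * ρ (p₂ i) y)))
    (hk : ∀ (i : ι₃) (y : Y), ∑ k' ∈ univ.filter (fun k' => p₄ k' = y), |k (EuclideanSpace.single k' (1 : ℝ)) i| ≤ Ck * Real.exp (-(a * ρ (p₃ i) y)))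
    (i : ι₀) (y : Y) :
    ∑ k' ∈ univ.filter (fun k' => p₄ k' = y), |(f ∘ₗ g ∘ₗ h ∘ₗ k) (EuclideanSpace.single k' (1 : ℝ)) i| ≤
      Cf * (Cg * (Ch * Ck * KY (a - a / 2)) * KY (a - a / 4)) * KY (a - a / 8) * Real.exp (-(a / 8 * ρ (p₀ i) y)) := by
  have h1 := blockBound_comp3r hρ hK g h k p₁ p₂ p₃ p₄ hCg hCh hCk ha hKY hg hh hk
  have h0 : 0 ≤ Cg * (Ch * Ck * KY (a - a / 2)) * KY (a - a / 4) :=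
    mul_nonneg (mul_nonneg hCg (mul_nonneg (mul_nonneg hCh hCk) (hKY _ (by linarith)))) (hKY _ (by linarith))
  exact blockBound_comp hρ hK f (g ∘ₗ h ∘ₗ k) p₀ p₁ p₄ hCf h0 (by positivity) (by linarith) (by linarith) hf h1 i y

end Abstract

variable {d L m K : ℕ} {hd : 1 ≤ d + 1} {hL : Odd L ∧ 1 < L} {j : ℕ}

/-! ## §1  Adjoints; `M = G^{(w′)}·R₀` -/

section Identities

variable {c : ℝ} (hc : c ≠ 0) (hj : j + 1 ≤ (⟨d + 1, L, m, K, hd, hL⟩ : Params).m + (⟨d + 1, L, m, K, hd, hL⟩ : Params).K) (Λ' : Finset (Site (⟨d + 1, L, m, K, hd, hL⟩ : Params) (j + 1))) {w : CIdx j Λ' → ℝ} (hw : ∀ i, 0 < w i)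

include hj hw in
/-- `G̃_j* = G̃_j` (the tree's `Gt_symm`). [cite: Balaban1984PropagatorsII, (2.131) p.246] -/
theorem adjoint_Gt_V1 : LinearMap.adjoint (tsV1 hc Λ' w).Gt = (tsV1 hc Λ' w).Gt :=
  ((LinearMap.eq_adjoint_iff _ _).2 fun x y => Gt_symm (isLattice Λ' hc hj hw) (positive Λ' hc hj w) x y).symm

include hj hw in
/-- `C̃* = C̃` (the tree's `Ct_symm`). [cite: Balaban1984PropagatorsII, (2.129) p.246] -/
theorem adjoint_Ct_V1 : LinearMap.adjoint (tsV1 hc Λ' w).Ct = (tsV1 hc Λ' w).Ct :=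
  ((LinearMap.eq_adjoint_iff _ _).2 fun x y => Ct_symm (isLattice Λ' hc hj hw) (positive Λ' hc hj w) x y).symm

include hj hw in
/-- `Δ_j* = Δ_j` (the tree's `Δj_symm`). [cite: Balaban1984PropagatorsII, (2.118) p.243] -/
theorem adjoint_Δj_V1 : LinearMap.adjoint (tsV1 hc Λ' w).Δj = (tsV1 hc Λ' w).Δj :=
  ((LinearMap.eq_adjoint_iff _ _).2 fun x y => Δj_symm (isLattice Λ' hc hj hw) x y).symm

include hj hw in
/-- `(G̃_j + H_jC̃H_j*)* = G̃_j + H_jC̃H_j*` (the tree's `M_symm`). [cite: Balaban1984PropagatorsII, (2.129) p.246] -/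
theorem adjoint_M_V1 :
    LinearMap.adjoint ((tsV1 hc Λ' w).Gt + (tsV1 hc Λ' w).Hj ∘ₗ (tsV1 hc Λ' w).Ct ∘ₗ LinearMap.adjoint (tsV1 hc Λ' w).Hj) =
      (tsV1 hc Λ' w).Gt + (tsV1 hc Λ' w).Hj ∘ₗ (tsV1 hc Λ' w).Ct ∘ₗ LinearMap.adjoint (tsV1 hc Λ' w).Hj :=
  ((LinearMap.eq_adjoint_iff _ _).2 fun x y => M_symm (isLattice Λ' hc hj hw) (positive Λ' hc hj w) x y).symm

end Identities

section IdentitiesScaled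

variable (hc : ((L : ℝ) ^ j) ≠ 0) (hj : j + 1 ≤ (⟨d + 1, L, m, K, hd, hL⟩ : Params).m + (⟨d + 1, L, m, K, hd, hL⟩ : Params).K) (Λ' : Finset (Site (⟨d + 1, L, m, K, hd, hL⟩ : Params) (j + 1))) {w : CIdx j Λ' → ℝ} (hw : ∀ i, 0 < w i)
  (hw' : (0 : ℝ) < 1 * ((L : ℝ) ^ j) ^ (d + 1))

include hj hw in
/-- `(Δ_j + w′)* = Δ_j + w′`. [cite: Balaban1984PropagatorsII, (2.118) p.243] -/
theorem adjoint_E_V1 : LinearMap.adjoint ((tsV1 hc Λ' w).Δj + (1 * ((L : ℝ) ^ j) ^ (d + 1)) • (LinearMap.id : UBond (⟨d + 1, L, m, K, hd, hL⟩ : Params) j →ₗ[ℝ] UBond (⟨d + 1, L, m, K, hd, hL⟩ : Params) j)) = ((tsV1 hc Λ' w).Δj + (1 * ((L : ℝ) ^ j) ^ (d + 1)) • (LinearMap.id : UBond (⟨d + 1, L, m, K, hd, hL⟩ : Params) j →ₗ[ℝ] UBond (⟨d + 1, L, m, K, hd, hL⟩ : Params) j)) := by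
  rw [map_add, map_smulₛₗ, LinearMap.adjoint_id, adjoint_Δj_V1 hc hj Λ' hw, starRingEnd_apply, star_trivial]

include hw in
/-- **`M = G^{(w′)}·R₀`**: `G̃_j + H_jC̃H_j* = G^{(w′)}(I − Q_j*(Δ_j + w′)Q_jG^{(w′)} + Q_j*(Δ_j + w′)C̃H_j*)` (file 6's `Gt_eq_comp_GE`, file 20's
`Hj_eq_GE_comp_V1`, `w′ = n^{d+1}`). [cite: Balaban1984PropagatorsII, (2.129)–(2.131) p.246] -/
theorem M_eq_GE_comp_R0 : ((tsV1 hc Λ' w).Gt + (tsV1 hc Λ' w).Hj ∘ₗ (tsV1 hc Λ' w).Ct ∘ₗ LinearMap.adjoint (tsV1 hc Λ' w).Hj) = (GE (Domains.whole (P := (⟨d + 1, L, m, K, hd, hL⟩ : Params)) j (Nat.le_of_succ_le hj)) hc (w := fun _ => 1 * ((L : ℝ) ^ j) ^ (d + 1)) (fun _ => hw')) ∘ₗ ((LinearMap.id - LinearMap.adjoint (tsV1 hc Λ' w).Qv ∘ₗ ((tsV1 hc Λ' w).Δj + (1 * ((L : ℝ) ^ j) ^ (d + 1)) • (LinearMap.id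 : UBond (⟨d + 1, L, m, K, hd, hL⟩ : Params) j →ₗ[ℝ] UBond (⟨d + 1, L, m, K, hd, hL⟩ : Params) j)) ∘ₗ (tsV1 hc Λ' w).Qv ∘ₗ (GE (Domains.whole (P := (⟨d + 1, L, m, K, hd, hL⟩ : Params)) j (Nat.le_of_succ_le hj)) hc (w := fun _ => 1 * ((L : ℝ) ^ j) ^ (d + 1)) (fun _ => hw')) + LinearMap.adjoint (tsV1 hc Λ' w).Qv ∘ₗ ((tsV1 hc Λ' w).Δj + (1 * ((L : ℝ) ^ j) ^ (d + 1)) • (LinearMap.id : UBond (⟨d + 1, L, m, K, hd, hL⟩ : Params) j →ₗ[ℝ] UBond (⟨d + 1, L, m, K, hd, hL⟩ : Params) j)) ∘ₗ (tsV1 hc Λ' w).Ct ∘ₗ LinearMap.adjoint (tsV1 hc Λ' w).Hj : BondSpace (⟨d + 1, L, m, K, hd, hL⟩ : Params) →ₗ[ℝ] BondSpace (⟨d + 1, L, m, K, hd, hL⟩ : Params))) := by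
  set HjA := LinearMap.adjoint (tsV1 hc Λ' w).Hj with hHjA
  rw [Gt_eq_comp_GE hc hj Λ' hw hw', Hj_eq_GE_comp_V1 hc hj Λ' hw hw']
  simp only [LinearMap.comp_add, LinearMap.comp_sub, LinearMap.sub_comp, LinearMap.add_comp, LinearMap.comp_id, LinearMap.id_comp,
    LinearMap.comp_assoc]

include hw in
/-- `R₀* = I − G^{(w′)}Q_j*(Δ_j + w′)Q_j + H_jC̃(Δ_j + w′)Q_j` (file 24's `adjoint_GEW`, §1). [cite: Balaban1984PropagatorsII, (2.129)–(2.131) p.246] -/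
theorem adjoint_R0_eq : LinearMap.adjoint ((LinearMap.id - LinearMap.adjoint (tsV1 hc Λ' w).Qv ∘ₗ ((tsV1 hc Λ' w).Δj + (1 * ((L : ℝ) ^ j) ^ (d + 1)) • (LinearMap.id : UBond (⟨d + 1, L, m, K, hd, hL⟩ : Params) j →ₗ[ℝ] UBond (⟨d + 1, L, m, K, hd, hL⟩ : Params) j)) ∘ₗ (tsV1 hc Λ' w).Qv ∘ₗ (GE (Domains.whole (P := (⟨d + 1, L, m, K, hd, hL⟩ : Params)) j (Nat.le_of_succ_le hj)) hc (w := fun _ => 1 * ((L : ℝ) ^ j) ^ (d + 1)) (fun _ => hw')) + LinearMap.adjoint (tsV1 hc Λ' w).Qv ∘ₗ ((tsV1 hc Λ' w).Δj + (1 * ((L : ℝ) ^ j) ^ (d + 1)) • (LinearMap.id : UBond (⟨d + 1, L, m, K, hd, hL⟩ : Params) j →ₗ[ℝ] UBond (⟨d + 1, L, m, K, hd, hL⟩ : Params) j)) ∘ₗ (tsV1 hc Λ' w).Ct ∘ₗ LinearMap.adjoint (tsV1 hc Λ' w).Hj : BondSpace (⟨d + 1, L, m, K, hd, hL⟩ :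 Params) →ₗ[ℝ] BondSpace (⟨d + 1, L, m, K, hd, hL⟩ : Params))) = ((LinearMap.id - (GE (Domains.whole (P := (⟨d + 1, L, m, K, hd, hL⟩ : Params)) j (Nat.le_of_succ_le hj)) hc (w := fun _ => 1 * ((L : ℝ) ^ j) ^ (d + 1)) (fun _ => hw')) ∘ₗ LinearMap.adjoint (tsV1 hc Λ' w).Qv ∘ₗ ((tsV1 hc Λ' w).Δj + (1 * ((L : ℝ) ^ j) ^ (d + 1)) • (LinearMap.id : UBond (⟨d + 1, L, m, K, hd, hL⟩ : Params) j →ₗ[ℝ] UBond (⟨d + 1, L, m, K, hd, hL⟩ : Params) j)) ∘ₗ (tsV1 hc Λ' w).Qv + (tsV1 hc Λ' w).Hj ∘ₗ (tsV1 hc Λ' w).Ct ∘ₗ ((tsV1 hc Λ' w).Δj + (1 * ((L : ℝ) ^ j) ^ (d + 1)) • (LinearMap.id : UBond (⟨d + 1, L, m, K, hd, hL⟩ : Params) j →ₗ[ℝ] UBond (⟨d + 1, L, m, K, hd, hL⟩ : Params) j)) ∘ₗ (tsV1 hc Λ' w).Qv : BondSpace (⟨d + 1, L, m, K, hd, hL⟩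 : Params) →ₗ[ℝ] BondSpace (⟨d + 1, L, m, K, hd, hL⟩ : Params))) := by
  rw [map_add, map_sub, LinearMap.adjoint_id, LinearMap.adjoint_comp, LinearMap.adjoint_comp, LinearMap.adjoint_comp,
    LinearMap.adjoint_comp, LinearMap.adjoint_comp, LinearMap.adjoint_comp, LinearMap.adjoint_adjoint, LinearMap.adjoint_adjoint,
    adjoint_E_V1 hc hj Λ' hw, adjoint_Ct_V1 hc hj Λ' hw, adjoint_GEW]
  simp only [LinearMap.comp_assoc]

end IdentitiesScaled

/-! ## §3  The four products and their adjoints: uniform row block bounds at the scaling (every power of `n` cancels) -/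

section Products

open Classical in
/-- **`Q_j*(Δ_j + w′)Q_jG^{(w′)}` HAS A UNIFORM BLOCK BOUND** (`c = L^j`, `w′ = n^{d+1}`): `Q_j*` `(n^{−(d+1)}e^{δ}, δ)`, `Δ_j + w′` `(n^{d+1}(A_Δ(d+1)+1), κ_Δ)`, `Q_j` `(e^{δ}, δ)`, `G^{(w′)}` `(C_G, δ_G)`. [cite: Balaban1984PropagatorsII, (2.129)–(2.131) p.246] -/
theorem blockBound_Y1_scaling (d L : ℕ) (hd : 1 ≤ d + 1) (hL : Odd L ∧ 1 < L) {a₀ a₁ : ℝ} (ha₀ : 0 < a₀) (ha₁ : a₀ ≤ a₁) :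
    ∃ δ : ℝ, 0 < δ ∧ ∃ C : ℝ, 0 ≤ C ∧ ∀ (m K : ℕ) (j : ℕ) (hc : ((L : ℝ) ^ j) ≠ 0)
      (hj : j + 1 ≤ (⟨d + 1, L, m, K, hd, hL⟩ : Params).m + (⟨d + 1, L, m, K, hd, hL⟩ : Params).K)
      (Λ' : Finset (Site (⟨d + 1, L, m, K, hd, hL⟩ : Params) (j + 1))) (w : CIdx j Λ' → ℝ)
      (hw0 : ∀ i, a₀ * ((L : ℝ) ^ j) ^ (d + 1) ≤ w i) (hw1 : ∀ i, w i ≤ a₁ * ((L : ℝ) ^ j) ^ (d + 1))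
      (hw' : (0 : ℝ) < 1 * ((L : ℝ) ^ j) ^ (d + 1))
      (b₀ : PBond (⟨d + 1, L, m, K, hd, hL⟩ : Params) 0) (y : Site (⟨d + 1, L, m, K, hd, hL⟩ : Params) j),
      ∑ b₀' ∈ univ.filter (fun b₀' : PBond (⟨d + 1, L, m, K, hd, hL⟩ : Params) 0 => iterBlockOf j b₀'.src = y),
          |(LinearMap.adjoint (tsV1 hc Λ' w).Qv ∘ₗ ((tsV1 hc Λ' w).Δj + (1 * ((L : ℝ) ^ j) ^ (d + 1)) • (LinearMap.id : UBond (⟨d + 1, L, m, K, hd, hL⟩ : Params) j →ₗ[ℝ] UBond (⟨d + 1, L, m, K, hd, hL⟩ : Params) j)) ∘ₗ (tsV1 hc Λ' w).Qv ∘ₗ (GE (Domains.whole (P := (⟨d + 1, L, m, K, hd, hL⟩ : Params)) j (Nat.le_of_succ_le hj)) hc (w := fun _ => 1 * ((L : ℝ) ^ j) ^ (d + 1)) (fun _ => hw'))) (EuclideanSpace.single b₀' (1 : ℝ)) b₀| ≤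
        C * Real.exp (-(δ * torusSupNorm (Mk (⟨d + 1, L, m, K, hd, hL⟩ : Params) j) (rep (Mk (⟨d + 1, L, m, K, hd, hL⟩ : Params) j) (iterBlockOf j b₀.src) - rep (Mk (⟨d + 1, L, m, K, hd, hL⟩ : Params) j) y))) := by
  obtain ⟨δG, hδG, CG, hCG, hG⟩ := blockBound_GE_scaling d L hd hL one_pos
  obtain ⟨δC, hδC, ECt, hECt, hCt⟩ := blockBound_Ct_scaling d L hd hL ha₀ ha₁
  set κΔ : ℝ := kappa166 (d + 1) / (d + 1) with hκΔ
  have hκΔ0 : 0 < κΔ := div_pos (kappa166_pos _) (by positivity)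
  set κH : ℝ := kappa163 (d + 1) / ((d : ℝ) + 1) with hκH
  have hκH0 : 0 < κH := div_pos (kappa163_pos _) (by positivity)
  set δ₀ : ℝ := min (min κΔ δG) (min δC κH) with hδ₀
  have hδ₀0 : 0 < δ₀ := lt_min (lt_min hκΔ0 hδG) (lt_min hδC hκH0)
  have hδ₀Δ : δ₀ ≤ κΔ := (min_le_left _ _).trans (min_le_left _ _)
  have hδ₀G : δ₀ ≤ δG := (min_le_left _ _).trans (min_le_right _ _)
  have hδ₀C : δ₀ ≤ δC := (min_le_right _ _).trans (min_le_left _ _)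
  have hδ₀H : δ₀ ≤ κH := (min_le_right _ _).trans (min_le_right _ _)
  set AΔ : ℝ := MC (d + 1) (kappa166 (d + 1)) * periodConst (kappa166 (d + 1)) d with hAΔ
  have hAΔ0 : 0 ≤ AΔ := ADelta_nonneg d
  set AH : ℝ := MG163 (d + 1) * periodConst (kappa163 (d + 1)) d with hAH
  have hAH0 : 0 ≤ AH := mul_nonneg (MG163_nonneg _) (periodConst_pos (kappa163_pos _) _).le
  set K₁ : ℝ := latticeConst (d + 1) (δ₀ - δ₀ / 2) with hK₁
  set K₂ : ℝ := latticeConst (d + 1) (δ₀ - δ₀ / 4) with hK₂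
  set K₃ : ℝ := latticeConst (d + 1) (δ₀ - δ₀ / 8) with hK₃
  have hK₁0 : 0 ≤ K₁ := latticeConst_nonneg _ (by linarith)
  have hK₂0 : 0 ≤ K₂ := latticeConst_nonneg _ (by linarith)
  have hK₃0 : 0 ≤ K₃ := latticeConst_nonneg _ (by linarith)
  have hL0 : 0 < L := by have := hL.2; omega
  haveI : NeZero L := ⟨by omega⟩
  have hLp : (0 : ℝ) < L := by exact_mod_cast hL0
  set C : ℝ := Real.exp δ₀ * ((AΔ * ((1 * (d + 1) : ℕ) : ℝ) + 1) * (Real.exp δ₀ * CG * K₁) * K₂) * K₃ with hC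
  have hC0 : 0 ≤ C := by positivity
  refine ⟨δ₀ / 8, by positivity, C, hC0, ?_⟩
  intro m K j hc hj Λ' w hw0 hw1 hw' b₀ y
  have hj' : j ≤ m + K := Nat.le_of_succ_le hj
  set N : ℝ := ((L : ℝ) ^ j) ^ (d + 1) with hN
  have hN0 : 0 < N := by positivity
  have hw : ∀ i, 0 < w i := fun i => lt_of_lt_of_le (by positivity) (hw0 i)
  have hρ : IsPseudoDist (fun t t' : Site (⟨d + 1, L, m, K, hd, hL⟩ : Params) j => torusSupNorm (Mk (⟨d + 1, L, m, K, hd, hL⟩ : Params) j) (rep (Mk (⟨d + 1, L, m, K, hd, hL⟩ : Params) j) t - rep (Mk (⟨d + 1, L, m, K, hd, hL⟩ : Params) j) t')) := torusDist_isPseudoDist (Mk (⟨d + 1, L, m, K, hd, hL⟩ : Params) j)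
  have hK : SumBound (fun t t' : Site (⟨d + 1, L, m, K, hd, hL⟩ : Params) j => torusSupNorm (Mk (⟨d + 1, L, m, K, hd, hL⟩ : Params) j) (rep (Mk (⟨d + 1, L, m, K, hd, hL⟩ : Params) j) t - rep (Mk (⟨d + 1, L, m, K, hd, hL⟩ : Params) j) t')) (fun a => latticeConst (d + 1) a) := torusDist_sumBound (Mk (⟨d + 1, L, m, K, hd, hL⟩ : Params) j)
  have hKY : ∀ t : ℝ, 0 < t → 0 ≤ latticeConst (d + 1) t := fun t ht => latticeConst_nonneg _ ht.le
  -- at `c = L^j`: `κ = N = n^{d+1}` and `η^{d+1} = N⁻¹`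
  have hκN : ((L : ℝ) ^ j) ^ 2 / (eta L j ^ (d + 1) * ((L : ℝ) ^ j) ^ 2) = N := by
    rw [hN, eta, inv_pow, div_eq_iff (by positivity)]
    field_simp
  have hηN : ((⟨d + 1, L, m, K, hd, hL⟩ : Params)).eta j ^ (d + 1) = N⁻¹ := by
    rw [hN, Params.eta, ← inv_pow, ← inv_pow]
  -- the factor bounds at the common rate `δ₀`
  have hQ : ∀ (b₀ : PBond (⟨d + 1, L, m, K, hd, hL⟩ : Params) 0) (y' : Site (⟨d + 1, L, m, K, hd, hL⟩ : Params) j),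
      ∑ b ∈ univ.filter (fun b : PBond (⟨d + 1, L, m, K, hd, hL⟩ : Params) j => b.src = y'), |LinearMap.adjoint (tsV1 hc Λ' w).Qv (EuclideanSpace.single b (1 : ℝ)) b₀| ≤
        N⁻¹ * Real.exp δ₀ * Real.exp (-(δ₀ * torusSupNorm (Mk (⟨d + 1, L, m, K, hd, hL⟩ : Params) j) (rep (Mk (⟨d + 1, L, m, K, hd, hL⟩ : Params) j) (iterBlockOf j b₀.src) - rep (Mk (⟨d + 1, L, m, K, hd, hL⟩ : Params) j) y'))) := by
    intro b₀ y'
    have h := blockBound_Qv_adjoint hc hj' Λ' w hδ₀0.le b₀ y'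
    rwa [hηN] at h
  have hQv : ∀ (b : PBond (⟨d + 1, L, m, K, hd, hL⟩ : Params) j) (y' : Site (⟨d + 1, L, m, K, hd, hL⟩ : Params) j),
      ∑ b₀ ∈ univ.filter (fun b₀ : PBond (⟨d + 1, L, m, K, hd, hL⟩ : Params) 0 => iterBlockOf j b₀.src = y'), |(tsV1 hc Λ' w).Qv (EuclideanSpace.single b₀ (1 : ℝ)) b| ≤
        Real.exp δ₀ * Real.exp (-(δ₀ * torusSupNorm (Mk (⟨d + 1, L, m, K, hd, hL⟩ : Params) j) (rep (Mk (⟨d + 1, L, m, K, hd, hL⟩ : Params) j) b.src - rep (Mk (⟨d + 1, L, m, K, hd, hL⟩ : Params) j) y'))) := fun b y' => blockBound_Qv hc hj' Λ' w hδ₀0.le b y'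
  have hE : ∀ (b : PBond (⟨d + 1, L, m, K, hd, hL⟩ : Params) j) (y' : Site (⟨d + 1, L, m, K, hd, hL⟩ : Params) j),
      ∑ b' ∈ univ.filter (fun b' : PBond (⟨d + 1, L, m, K, hd, hL⟩ : Params) j => b'.src = y'), |((tsV1 hc Λ' w).Δj + (1 * ((L : ℝ) ^ j) ^ (d + 1)) • (LinearMap.id : UBond (⟨d + 1, L, m, K, hd, hL⟩ : Params) j →ₗ[ℝ] UBond (⟨d + 1, L, m, K, hd, hL⟩ : Params) j)) (EuclideanSpace.single b' (1 : ℝ)) b| ≤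
        N * (AΔ * ((1 * (d + 1) : ℕ) : ℝ) + 1) * Real.exp (-(δ₀ * torusSupNorm (Mk (⟨d + 1, L, m, K, hd, hL⟩ : Params) j) (rep (Mk (⟨d + 1, L, m, K, hd, hL⟩ : Params) j) b.src - rep (Mk (⟨d + 1, L, m, K, hd, hL⟩ : Params) j) y'))) := by
    intro b y'
    have hΔ : ∀ (b : PBond (⟨d + 1, L, m, K, hd, hL⟩ : Params) j) (y' : Site (⟨d + 1, L, m, K, hd, hL⟩ : Params) j),
        ∑ b' ∈ univ.filter (fun b' : PBond (⟨d + 1, L, m, K, hd, hL⟩ : Params) j => b'.src = y'), |(tsV1 hc Λ' w).Δj (EuclideanSpace.single b' (1 : ℝ)) b| ≤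
          N * AΔ * ((1 * (d + 1) : ℕ) : ℝ) * Real.exp (-(κΔ * torusSupNorm (Mk (⟨d + 1, L, m, K, hd, hL⟩ : Params) j) (rep (Mk (⟨d + 1, L, m, K, hd, hL⟩ : Params) j) b.src - rep (Mk (⟨d + 1, L, m, K, hd, hL⟩ : Params) j) y'))) := by
      intro b y'
      have h := blockBound_Δj hc hj Λ' hw b y'
      rwa [hκN] at h
    have hI : ∀ (b : PBond (⟨d + 1, L, m, K, hd, hL⟩ : Params) j) (y' : Site (⟨d + 1, L, m, K, hd, hL⟩ : Params) j),
        ∑ b' ∈ univ.filter (fun b' : PBond (⟨d + 1, L, m, K, hd, hL⟩ : Params) j => b'.src = y'),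
            |((1 * ((L : ℝ) ^ j) ^ (d + 1)) • (LinearMap.id : UBond (⟨d + 1, L, m, K, hd, hL⟩ : Params) j →ₗ[ℝ] UBond (⟨d + 1, L, m, K, hd, hL⟩ : Params) j)) (EuclideanSpace.single b' (1 : ℝ)) b| ≤
          |1 * ((L : ℝ) ^ j) ^ (d + 1)| * 1 * Real.exp (-(κΔ * torusSupNorm (Mk (⟨d + 1, L, m, K, hd, hL⟩ : Params) j) (rep (Mk (⟨d + 1, L, m, K, hd, hL⟩ : Params) j) b.src - rep (Mk (⟨d + 1, L, m, K, hd, hL⟩ : Params) j) y'))) :=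
      fun b y' => blockBound_smul (ρ := (fun t t' : Site (⟨d + 1, L, m, K, hd, hL⟩ : Params) j => torusSupNorm (Mk (⟨d + 1, L, m, K, hd, hL⟩ : Params) j) (rep (Mk (⟨d + 1, L, m, K, hd, hL⟩ : Params) j) t - rep (Mk (⟨d + 1, L, m, K, hd, hL⟩ : Params) j) t'))) _ (fun b : PBond (⟨d + 1, L, m, K, hd, hL⟩ : Params) j => b.src) (fun b : PBond (⟨d + 1, L, m, K, hd, hL⟩ : Params) j => b.src) _ (fun b y' => blockBound_id hρ (fun b : PBond (⟨d + 1, L, m, K, hd, hL⟩ : Params) j => b.src) κΔ b y') b y'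
    have h := blockBound_add (ρ := (fun t t' : Site (⟨d + 1, L, m, K, hd, hL⟩ : Params) j => torusSupNorm (Mk (⟨d + 1, L, m, K, hd, hL⟩ : Params) j) (rep (Mk (⟨d + 1, L, m, K, hd, hL⟩ : Params) j) t - rep (Mk (⟨d + 1, L, m, K, hd, hL⟩ : Params) j) t'))) _ _ (fun b : PBond (⟨d + 1, L, m, K, hd, hL⟩ : Params) j => b.src) (fun b : PBond (⟨d + 1, L, m, K, hd, hL⟩ : Params) j => b.src) hΔ hI
    have h' := blockBound_mono hρ ((tsV1 hc Λ' w).Δj + (1 * ((L : ℝ) ^ j) ^ (d + 1)) • (LinearMap.id : UBond (⟨d + 1, L, m, K, hd, hL⟩ : Params) j →ₗ[ℝ] UBond (⟨d + 1, L, m, K, hd, hL⟩ : Params) j)) (fun b : PBond (⟨d + 1, L, m, K, hd, hL⟩ : Params) j => b.src) (fun b : PBond (⟨d + 1, L, m, K, hd, hL⟩ : Params) j => b.src) (C' := N * (AΔ * ((1 * (d + 1) : ℕ) : ℝ) + 1)) (by positivity)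
      (le_of_eq (by rw [abs_of_pos hw', hN]; ring)) hδ₀Δ h
    exact h' b y'
  have hGb := blockBound_mono hρ (GE (Domains.whole (P := (⟨d + 1, L, m, K, hd, hL⟩ : Params)) j (Nat.le_of_succ_le hj)) hc (w := fun _ => 1 * ((L : ℝ) ^ j) ^ (d + 1)) (fun _ => hw')) (fun b₀ : PBond (⟨d + 1, L, m, K, hd, hL⟩ : Params) 0 => iterBlockOf j b₀.src) (fun b₀ : PBond (⟨d + 1, L, m, K, hd, hL⟩ : Params) 0 => iterBlockOf j b₀.src) hCG le_rfl hδ₀G (hG m K j hj' hc hw')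
  have h := blockBound_comp4r hρ hK (LinearMap.adjoint (tsV1 hc Λ' w).Qv) ((tsV1 hc Λ' w).Δj + (1 * ((L : ℝ) ^ j) ^ (d + 1)) • (LinearMap.id : UBond (⟨d + 1, L, m, K, hd, hL⟩ : Params) j →ₗ[ℝ] UBond (⟨d + 1, L, m, K, hd, hL⟩ : Params) j)) (tsV1 hc Λ' w).Qv (GE (Domains.whole (P := (⟨d + 1, L, m, K, hd, hL⟩ : Params)) j (Nat.le_of_succ_le hj)) hc (w := fun _ => 1 * ((L : ℝ) ^ j) ^ (d + 1)) (fun _ => hw')) (fun b₀ : PBond (⟨d + 1, L, m, K, hd, hL⟩ : Params) 0 => iterBlockOf j b₀.src) (fun b : PBond (⟨d + 1, L, m, K, hd, hL⟩ : Params) j => b.src) (fun b : PBond (⟨d + 1, L, m, K, hd, hL⟩ : Params) j => b.src) (fun b₀ : PBond (⟨d + 1, L, m, K, hd, hL⟩ : Params) 0 => iterBlockOf j b₀.src) (fun b₀ : PBond (⟨d + 1, L, m, K, hd, hL⟩ : Params) 0 => iterBlockOf j b₀.src)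
    (by positivity) (by positivity) (by positivity) hCG hδ₀0 hKY hQ hE hQv hGb b₀ y
  refine h.trans (le_of_eq ?_)
  rw [hC, hK₁, hK₂, hK₃]
  field_simp
set_option maxHeartbeats 400000 in
open Classical in
/-- **`Q_j*(Δ_j + w′)C̃H_j*` HAS A UNIFORM BLOCK BOUND** (`c = L^j`): `C̃` `(E/n^{d+1}, δ_C)` (file 8), `H_j*` `(A_Hn^{d+1}(d+1), κ_H)` (file 5). [cite: Balaban1984PropagatorsII, (2.129)–(2.131) p.246] -/
theorem blockBound_Y2_scaling (d L : ℕ) (hd : 1 ≤ d + 1) (hL : Odd L ∧ 1 < L) {a₀ a₁ : ℝ} (ha₀ : 0 < a₀) (ha₁ : a₀ ≤ a₁) :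
    ∃ δ : ℝ, 0 < δ ∧ ∃ C : ℝ, 0 ≤ C ∧ ∀ (m K : ℕ) (j : ℕ) (hc : ((L : ℝ) ^ j) ≠ 0)
      (hj : j + 1 ≤ (⟨d + 1, L, m, K, hd, hL⟩ : Params).m + (⟨d + 1, L, m, K, hd, hL⟩ : Params).K)
      (Λ' : Finset (Site (⟨d + 1, L, m, K, hd, hL⟩ : Params) (j + 1))) (w : CIdx j Λ' → ℝ)
      (hw0 : ∀ i, a₀ * ((L : ℝ) ^ j) ^ (d + 1) ≤ w i) (hw1 : ∀ i, w i ≤ a₁ * ((L : ℝ) ^ j) ^ (d + 1))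
      (hw' : (0 : ℝ) < 1 * ((L : ℝ) ^ j) ^ (d + 1))
      (b₀ : PBond (⟨d + 1, L, m, K, hd, hL⟩ : Params) 0) (y : Site (⟨d + 1, L, m, K, hd, hL⟩ : Params) j),
      ∑ b₀' ∈ univ.filter (fun b₀' : PBond (⟨d + 1, L, m, K, hd, hL⟩ : Params) 0 => iterBlockOf j b₀'.src = y),
          |(LinearMap.adjoint (tsV1 hc Λ' w).Qv ∘ₗ ((tsV1 hc Λ' w).Δj + (1 * ((L : ℝ) ^ j) ^ (d + 1)) • (LinearMap.id : UBond (⟨d + 1, L, m, K, hd, hL⟩ : Params) j →ₗ[ℝ] UBond (⟨d + 1, L, m, K, hd, hL⟩ : Params) j)) ∘ₗ (tsV1 hc Λ' w).Ct ∘ₗ LinearMap.adjoint (tsV1 hc Λ' w).Hj) (EuclideanSpace.single b₀' (1 : ℝ)) b₀| ≤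
        C * Real.exp (-(δ * torusSupNorm (Mk (⟨d + 1, L, m, K, hd, hL⟩ : Params) j) (rep (Mk (⟨d + 1, L, m, K, hd, hL⟩ : Params) j) (iterBlockOf j b₀.src) - rep (Mk (⟨d + 1, L, m, K, hd, hL⟩ : Params) j) y))) := by
  obtain ⟨δG, hδG, CG, hCG, hG⟩ := blockBound_GE_scaling d L hd hL one_pos
  obtain ⟨δC, hδC, ECt, hECt, hCt⟩ := blockBound_Ct_scaling d L hd hL ha₀ ha₁
  set κΔ : ℝ := kappa166 (d + 1) / (d + 1) with hκΔ
  have hκΔ0 : 0 < κΔ := div_pos (kappa166_pos _) (by positivity)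
  set κH : ℝ := kappa163 (d + 1) / ((d : ℝ) + 1) with hκH
  have hκH0 : 0 < κH := div_pos (kappa163_pos _) (by positivity)
  set δ₀ : ℝ := min (min κΔ δG) (min δC κH) with hδ₀
  have hδ₀0 : 0 < δ₀ := lt_min (lt_min hκΔ0 hδG) (lt_min hδC hκH0)
  have hδ₀Δ : δ₀ ≤ κΔ := (min_le_left _ _).trans (min_le_left _ _)
  have hδ₀G : δ₀ ≤ δG := (min_le_left _ _).trans (min_le_right _ _)
  have hδ₀C : δ₀ ≤ δC := (min_le_right _ _).trans (min_le_left _ _)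
  have hδ₀H : δ₀ ≤ κH := (min_le_right _ _).trans (min_le_right _ _)
  set AΔ : ℝ := MC (d + 1) (kappa166 (d + 1)) * periodConst (kappa166 (d + 1)) d with hAΔ
  have hAΔ0 : 0 ≤ AΔ := ADelta_nonneg d
  set AH : ℝ := MG163 (d + 1) * periodConst (kappa163 (d + 1)) d with hAH
  have hAH0 : 0 ≤ AH := mul_nonneg (MG163_nonneg _) (periodConst_pos (kappa163_pos _) _).le
  set K₁ : ℝ := latticeConst (d + 1) (δ₀ - δ₀ / 2) with hK₁
  set K₂ : ℝ := latticeConst (d + 1) (δ₀ - δ₀ / 4) with hK₂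
  set K₃ : ℝ := latticeConst (d + 1) (δ₀ - δ₀ / 8) with hK₃
  have hK₁0 : 0 ≤ K₁ := latticeConst_nonneg _ (by linarith)
  have hK₂0 : 0 ≤ K₂ := latticeConst_nonneg _ (by linarith)
  have hK₃0 : 0 ≤ K₃ := latticeConst_nonneg _ (by linarith)
  have hL0 : 0 < L := by have := hL.2; omega
  haveI : NeZero L := ⟨by omega⟩
  have hLp : (0 : ℝ) < L := by exact_mod_cast hL0
  set C : ℝ := Real.exp δ₀ * ((AΔ * ((1 * (d + 1) : ℕ) : ℝ) + 1) * (ECt * (AH * ((d + 1 : ℕ) : ℝ)) * K₁) * K₂) * K₃ with hC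
  have hC0 : 0 ≤ C := by positivity
  refine ⟨δ₀ / 8, by positivity, C, hC0, ?_⟩
  intro m K j hc hj Λ' w hw0 hw1 hw' b₀ y
  have hj' : j ≤ m + K := Nat.le_of_succ_le hj
  set N : ℝ := ((L : ℝ) ^ j) ^ (d + 1) with hN
  have hN0 : 0 < N := by positivity
  have hw : ∀ i, 0 < w i := fun i => lt_of_lt_of_le (by positivity) (hw0 i)
  have hρ : IsPseudoDist (fun t t' : Site (⟨d + 1, L, m, K, hd, hL⟩ : Params) j => torusSupNorm (Mk (⟨d + 1, L, m, K, hd, hL⟩ : Params) j) (rep (Mk (⟨d + 1, L, m, K, hd, hL⟩ : Params) j) t - rep (Mk (⟨d + 1, L, m, K, hd, hL⟩ : Params) j) t')) := torusDist_isPseudoDist (Mk (⟨d + 1, L, m, K, hd, hL⟩ : Params) j)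
  have hK : SumBound (fun t t' : Site (⟨d + 1, L, m, K, hd, hL⟩ : Params) j => torusSupNorm (Mk (⟨d + 1, L, m, K, hd, hL⟩ : Params) j) (rep (Mk (⟨d + 1, L, m, K, hd, hL⟩ : Params) j) t - rep (Mk (⟨d + 1, L, m, K, hd, hL⟩ : Params) j) t')) (fun a => latticeConst (d + 1) a) := torusDist_sumBound (Mk (⟨d + 1, L, m, K, hd, hL⟩ : Params) j)
  have hKY : ∀ t : ℝ, 0 < t → 0 ≤ latticeConst (d + 1) t := fun t ht => latticeConst_nonneg _ ht.le
  -- at `c = L^j`: `κ = N = n^{d+1}` and `η^{d+1} = N⁻¹`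
  have hκN : ((L : ℝ) ^ j) ^ 2 / (eta L j ^ (d + 1) * ((L : ℝ) ^ j) ^ 2) = N := by
    rw [hN, eta, inv_pow, div_eq_iff (by positivity)]
    field_simp
  have hηN : ((⟨d + 1, L, m, K, hd, hL⟩ : Params)).eta j ^ (d + 1) = N⁻¹ := by
    rw [hN, Params.eta, ← inv_pow, ← inv_pow]
  -- the factor bounds at the common rate `δ₀`
  have hQ : ∀ (b₀ : PBond (⟨d + 1, L, m, K, hd, hL⟩ : Params) 0) (y' : Site (⟨d + 1, L, m, K, hd, hL⟩ : Params) j),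
      ∑ b ∈ univ.filter (fun b : PBond (⟨d + 1, L, m, K, hd, hL⟩ : Params) j => b.src = y'), |LinearMap.adjoint (tsV1 hc Λ' w).Qv (EuclideanSpace.single b (1 : ℝ)) b₀| ≤
        N⁻¹ * Real.exp δ₀ * Real.exp (-(δ₀ * torusSupNorm (Mk (⟨d + 1, L, m, K, hd, hL⟩ : Params) j) (rep (Mk (⟨d + 1, L, m, K, hd, hL⟩ : Params) j) (iterBlockOf j b₀.src) - rep (Mk (⟨d + 1, L, m, K, hd, hL⟩ : Params) j) y'))) := by
    intro b₀ y'
    have h := blockBound_Qv_adjoint hc hj' Λ' w hδ₀0.le b₀ y'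
    rwa [hηN] at h
  have hQv : ∀ (b : PBond (⟨d + 1, L, m, K, hd, hL⟩ : Params) j) (y' : Site (⟨d + 1, L, m, K, hd, hL⟩ : Params) j),
      ∑ b₀ ∈ univ.filter (fun b₀ : PBond (⟨d + 1, L, m, K, hd, hL⟩ : Params) 0 => iterBlockOf j b₀.src = y'), |(tsV1 hc Λ' w).Qv (EuclideanSpace.single b₀ (1 : ℝ)) b| ≤
        Real.exp δ₀ * Real.exp (-(δ₀ * torusSupNorm (Mk (⟨d + 1, L, m, K, hd, hL⟩ : Params) j) (rep (Mk (⟨d + 1, L, m, K, hd, hL⟩ : Params) j) b.src - rep (Mk (⟨d + 1, L, m, K, hd, hL⟩ : Params) j) y'))) := fun b y' => blockBound_Qv hc hj' Λ' w hδ₀0.le b y'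
  have hE : ∀ (b : PBond (⟨d + 1, L, m, K, hd, hL⟩ : Params) j) (y' : Site (⟨d + 1, L, m, K, hd, hL⟩ : Params) j),
      ∑ b' ∈ univ.filter (fun b' : PBond (⟨d + 1, L, m, K, hd, hL⟩ : Params) j => b'.src = y'), |((tsV1 hc Λ' w).Δj + (1 * ((L : ℝ) ^ j) ^ (d + 1)) • (LinearMap.id : UBond (⟨d + 1, L, m, K, hd, hL⟩ : Params) j →ₗ[ℝ] UBond (⟨d + 1, L, m, K, hd, hL⟩ : Params) j)) (EuclideanSpace.single b' (1 : ℝ)) b| ≤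
        N * (AΔ * ((1 * (d + 1) : ℕ) : ℝ) + 1) * Real.exp (-(δ₀ * torusSupNorm (Mk (⟨d + 1, L, m, K, hd, hL⟩ : Params) j) (rep (Mk (⟨d + 1, L, m, K, hd, hL⟩ : Params) j) b.src - rep (Mk (⟨d + 1, L, m, K, hd, hL⟩ : Params) j) y'))) := by
    intro b y'
    have hΔ : ∀ (b : PBond (⟨d + 1, L, m, K, hd, hL⟩ : Params) j) (y' : Site (⟨d + 1, L, m, K, hd, hL⟩ : Params) j),
        ∑ b' ∈ univ.filter (fun b' : PBond (⟨d + 1, L, m, K, hd, hL⟩ : Params) j => b'.src = y'), |(tsV1 hc Λ' w).Δj (EuclideanSpace.single b' (1 : ℝ)) b| ≤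
          N * AΔ * ((1 * (d + 1) : ℕ) : ℝ) * Real.exp (-(κΔ * torusSupNorm (Mk (⟨d + 1, L, m, K, hd, hL⟩ : Params) j) (rep (Mk (⟨d + 1, L, m, K, hd, hL⟩ : Params) j) b.src - rep (Mk (⟨d + 1, L, m, K, hd, hL⟩ : Params) j) y'))) := by
      intro b y'
      have h := blockBound_Δj hc hj Λ' hw b y'
      rwa [hκN] at h
    have hI : ∀ (b : PBond (⟨d + 1, L, m, K, hd, hL⟩ : Params) j) (y' : Site (⟨d + 1, L, m, K, hd, hL⟩ : Params) j),
        ∑ b' ∈ univ.filter (fun b' : PBond (⟨d + 1, L, m, K, hd, hL⟩ : Params) j => b'.src = y'),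
            |((1 * ((L : ℝ) ^ j) ^ (d + 1)) • (LinearMap.id : UBond (⟨d + 1, L, m, K, hd, hL⟩ : Params) j →ₗ[ℝ] UBond (⟨d + 1, L, m, K, hd, hL⟩ : Params) j)) (EuclideanSpace.single b' (1 : ℝ)) b| ≤
          |1 * ((L : ℝ) ^ j) ^ (d + 1)| * 1 * Real.exp (-(κΔ * torusSupNorm (Mk (⟨d + 1, L, m, K, hd, hL⟩ : Params) j) (rep (Mk (⟨d + 1, L, m, K, hd, hL⟩ : Params) j) b.src - rep (Mk (⟨d + 1, L, m, K, hd, hL⟩ : Params) j) y'))) :=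
      fun b y' => blockBound_smul (ρ := (fun t t' : Site (⟨d + 1, L, m, K, hd, hL⟩ : Params) j => torusSupNorm (Mk (⟨d + 1, L, m, K, hd, hL⟩ : Params) j) (rep (Mk (⟨d + 1, L, m, K, hd, hL⟩ : Params) j) t - rep (Mk (⟨d + 1, L, m, K, hd, hL⟩ : Params) j) t'))) _ (fun b : PBond (⟨d + 1, L, m, K, hd, hL⟩ : Params) j => b.src) (fun b : PBond (⟨d + 1, L, m, K, hd, hL⟩ : Params) j => b.src) _ (fun b y' => blockBound_id hρ (fun b : PBond (⟨d + 1, L, m, K, hd, hL⟩ : Params) j => b.src) κΔ b y') b y'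
    have h := blockBound_add (ρ := (fun t t' : Site (⟨d + 1, L, m, K, hd, hL⟩ : Params) j => torusSupNorm (Mk (⟨d + 1, L, m, K, hd, hL⟩ : Params) j) (rep (Mk (⟨d + 1, L, m, K, hd, hL⟩ : Params) j) t - rep (Mk (⟨d + 1, L, m, K, hd, hL⟩ : Params) j) t'))) _ _ (fun b : PBond (⟨d + 1, L, m, K, hd, hL⟩ : Params) j => b.src) (fun b : PBond (⟨d + 1, L, m, K, hd, hL⟩ : Params) j => b.src) hΔ hI
    have h' := blockBound_mono hρ ((tsV1 hc Λ' w).Δj + (1 * ((L : ℝ) ^ j) ^ (d + 1)) • (LinearMap.id : UBond (⟨d + 1, L, m, K, hd, hL⟩ : Params) j →ₗ[ℝ] UBond (⟨d + 1, L, m, K, hd, hL⟩ : Params) j)) (fun b : PBond (⟨d + 1, L, m, K, hd, hL⟩ : Params) j => b.src) (fun b : PBond (⟨d + 1, L, m, K, hd, hL⟩ : Params) j => b.src) (C' := N * (AΔ * ((1 * (d + 1) : ℕ) : ℝ) + 1)) (by positivity)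
      (le_of_eq (by rw [abs_of_pos hw', hN]; ring)) hδ₀Δ h
    exact h' b y'
  have hcast : (((L ^ j) ^ (d + 1) * (d + 1) : ℕ) : ℝ) = N * ((d + 1 : ℕ) : ℝ) := by rw [hN]; push_cast; ring
  have hCtb : ∀ (b : PBond (⟨d + 1, L, m, K, hd, hL⟩ : Params) j) (y' : Site (⟨d + 1, L, m, K, hd, hL⟩ : Params) j),
      ∑ b' ∈ univ.filter (fun b' : PBond (⟨d + 1, L, m, K, hd, hL⟩ : Params) j => b'.src = y'), |(tsV1 hc Λ' w).Ct (EuclideanSpace.single b' (1 : ℝ)) b| ≤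
        ECt / N * Real.exp (-(δ₀ * torusSupNorm (Mk (⟨d + 1, L, m, K, hd, hL⟩ : Params) j) (rep (Mk (⟨d + 1, L, m, K, hd, hL⟩ : Params) j) b.src - rep (Mk (⟨d + 1, L, m, K, hd, hL⟩ : Params) j) y'))) :=
    blockBound_mono hρ (tsV1 hc Λ' w).Ct (fun b : PBond (⟨d + 1, L, m, K, hd, hL⟩ : Params) j => b.src) (fun b : PBond (⟨d + 1, L, m, K, hd, hL⟩ : Params) j => b.src) (by positivity) le_rfl hδ₀C (hCt m K j hc hj Λ' w hw0 hw1)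
  have hHa : ∀ (b : PBond (⟨d + 1, L, m, K, hd, hL⟩ : Params) j) (y' : Site (⟨d + 1, L, m, K, hd, hL⟩ : Params) j),
      ∑ b₀ ∈ univ.filter (fun b₀ : PBond (⟨d + 1, L, m, K, hd, hL⟩ : Params) 0 => iterBlockOf j b₀.src = y'), |LinearMap.adjoint (tsV1 hc Λ' w).Hj (EuclideanSpace.single b₀ (1 : ℝ)) b| ≤
        AH * (N * ((d + 1 : ℕ) : ℝ)) * Real.exp (-(δ₀ * torusSupNorm (Mk (⟨d + 1, L, m, K, hd, hL⟩ : Params) j) (rep (Mk (⟨d + 1, L, m, K, hd, hL⟩ : Params) j) b.src - rep (Mk (⟨d + 1, L, m, K, hd, hL⟩ : Params) j) y'))) := by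
    refine blockBound_mono hρ (LinearMap.adjoint (tsV1 hc Λ' w).Hj) (fun b : PBond (⟨d + 1, L, m, K, hd, hL⟩ : Params) j => b.src) (fun b₀ : PBond (⟨d + 1, L, m, K, hd, hL⟩ : Params) 0 => iterBlockOf j b₀.src) (by positivity) (le_of_eq ?_) hδ₀H (fun b y' => blockBound_Hj_adjoint hc hj Λ' hw b y')
    rw [hcast]
  have h := blockBound_comp4r hρ hK (LinearMap.adjoint (tsV1 hc Λ' w).Qv) ((tsV1 hc Λ' w).Δj + (1 * ((L : ℝ) ^ j) ^ (d + 1)) • (LinearMap.id : UBond (⟨d + 1, L, m, K, hd, hL⟩ : Params) j →ₗ[ℝ] UBond (⟨d + 1, L, m, K, hd, hL⟩ : Params) j)) (tsV1 hc Λ' w).Ct (LinearMap.adjoint (tsV1 hc Λ' w).Hj) (fun b₀ : PBond (⟨d + 1, L, m, K, hd, hL⟩ : Params) 0 => iterBlockOf j b₀.src) (fun b : PBond (⟨d + 1, L, m, K, hd, hL⟩ : Params) j => b.src) (fun b : PBond (⟨d + 1, L, m, K, hd, hL⟩ : Params) j => b.src) (fun b : PBond (⟨d + 1, L, m, K, hd,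 hL⟩ : Params) j => b.src) (fun b₀ : PBond (⟨d + 1, L, m, K, hd, hL⟩ : Params) 0 => iterBlockOf j b₀.src)
    (by positivity) (by positivity) (by positivity) (by positivity) hδ₀0 hKY hQ hE hCtb hHa b₀ y
  refine h.trans (le_of_eq ?_)
  rw [hC, hK₁, hK₂, hK₃]
  field_simp

open Classical in
/-- **`G^{(w′)}Q_j*(Δ_j + w′)Q_j` HAS A UNIFORM BLOCK BOUND** (the adjoint of `Q_j*(Δ_j + w′)Q_jG^{(w′)}`). [cite: Balaban1984PropagatorsII, (2.129)–(2.131) p.246] -/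
theorem blockBound_Y1adj_scaling (d L : ℕ) (hd : 1 ≤ d + 1) (hL : Odd L ∧ 1 < L) {a₀ a₁ : ℝ} (ha₀ : 0 < a₀) (ha₁ : a₀ ≤ a₁) :
    ∃ δ : ℝ, 0 < δ ∧ ∃ C : ℝ, 0 ≤ C ∧ ∀ (m K : ℕ) (j : ℕ) (hc : ((L : ℝ) ^ j) ≠ 0)
      (hj : j + 1 ≤ (⟨d + 1, L, m, K, hd, hL⟩ : Params).m + (⟨d + 1, L, m, K, hd, hL⟩ : Params).K)
      (Λ' : Finset (Site (⟨d + 1, L, m, K, hd, hL⟩ : Params) (j + 1))) (w : CIdx j Λ' → ℝ)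
      (hw0 : ∀ i, a₀ * ((L : ℝ) ^ j) ^ (d + 1) ≤ w i) (hw1 : ∀ i, w i ≤ a₁ * ((L : ℝ) ^ j) ^ (d + 1))
      (hw' : (0 : ℝ) < 1 * ((L : ℝ) ^ j) ^ (d + 1))
      (b₀ : PBond (⟨d + 1, L, m, K, hd, hL⟩ : Params) 0) (y : Site (⟨d + 1, L, m, K, hd, hL⟩ : Params) j),
      ∑ b₀' ∈ univ.filter (fun b₀' : PBond (⟨d + 1, L, m, K, hd, hL⟩ : Params) 0 => iterBlockOf j b₀'.src = y),
          |((GE (Domains.whole (P := (⟨d + 1, L, m, K, hd, hL⟩ : Params)) j (Nat.le_of_succ_le hj)) hc (w := fun _ => 1 * ((L : ℝ) ^ j) ^ (d + 1)) (fun _ => hw')) ∘ₗ LinearMap.adjoint (tsV1 hc Λ' w).Qv ∘ₗ ((tsV1 hc Λ' w).Δj + (1 * ((L : ℝ) ^ j) ^ (d + 1)) • (LinearMap.id : UBond (⟨d + 1, L, m, K, hd, hL⟩ : Params) j →ₗ[ℝ] UBond (⟨d + 1, L, m, K, hd, hL⟩ : Params) j)) ∘ₗ (tsV1 hc Λ'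 w).Qv) (EuclideanSpace.single b₀' (1 : ℝ)) b₀| ≤
        C * Real.exp (-(δ * torusSupNorm (Mk (⟨d + 1, L, m, K, hd, hL⟩ : Params) j) (rep (Mk (⟨d + 1, L, m, K, hd, hL⟩ : Params) j) (iterBlockOf j b₀.src) - rep (Mk (⟨d + 1, L, m, K, hd, hL⟩ : Params) j) y))) := by
  obtain ⟨δG, hδG, CG, hCG, hG⟩ := blockBound_GE_scaling d L hd hL one_pos
  obtain ⟨δC, hδC, ECt, hECt, hCt⟩ := blockBound_Ct_scaling d L hd hL ha₀ ha₁
  set κΔ : ℝ := kappa166 (d + 1) / (d + 1) with hκΔ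
  have hκΔ0 : 0 < κΔ := div_pos (kappa166_pos _) (by positivity)
  set κH : ℝ := kappa163 (d + 1) / ((d : ℝ) + 1) with hκH
  have hκH0 : 0 < κH := div_pos (kappa163_pos _) (by positivity)
  set δ₀ : ℝ := min (min κΔ δG) (min δC κH) with hδ₀
  have hδ₀0 : 0 < δ₀ := lt_min (lt_min hκΔ0 hδG) (lt_min hδC hκH0)
  have hδ₀Δ : δ₀ ≤ κΔ := (min_le_left _ _).trans (min_le_left _ _)
  have hδ₀G : δ₀ ≤ δG := (min_le_left _ _).trans (min_le_right _ _)
  have hδ₀C : δ₀ ≤ δC := (min_le_right _ _).trans (min_le_left _ _)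
  have hδ₀H : δ₀ ≤ κH := (min_le_right _ _).trans (min_le_right _ _)
  set AΔ : ℝ := MC (d + 1) (kappa166 (d + 1)) * periodConst (kappa166 (d + 1)) d with hAΔ
  have hAΔ0 : 0 ≤ AΔ := ADelta_nonneg d
  set AH : ℝ := MG163 (d + 1) * periodConst (kappa163 (d + 1)) d with hAH
  have hAH0 : 0 ≤ AH := mul_nonneg (MG163_nonneg _) (periodConst_pos (kappa163_pos _) _).le
  set K₁ : ℝ := latticeConst (d + 1) (δ₀ - δ₀ / 2) with hK₁
  set K₂ : ℝ := latticeConst (d + 1) (δ₀ - δ₀ / 4) with hK₂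
  set K₃ : ℝ := latticeConst (d + 1) (δ₀ - δ₀ / 8) with hK₃
  have hK₁0 : 0 ≤ K₁ := latticeConst_nonneg _ (by linarith)
  have hK₂0 : 0 ≤ K₂ := latticeConst_nonneg _ (by linarith)
  have hK₃0 : 0 ≤ K₃ := latticeConst_nonneg _ (by linarith)
  have hL0 : 0 < L := by have := hL.2; omega
  haveI : NeZero L := ⟨by omega⟩
  have hLp : (0 : ℝ) < L := by exact_mod_cast hL0
  set C : ℝ := CG * (Real.exp δ₀ * ((AΔ * ((1 * (d + 1) : ℕ) : ℝ) + 1) * Real.exp δ₀ * K₁) * K₂) * K₃ with hC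
  have hC0 : 0 ≤ C := by positivity
  refine ⟨δ₀ / 8, by positivity, C, hC0, ?_⟩
  intro m K j hc hj Λ' w hw0 hw1 hw' b₀ y
  have hj' : j ≤ m + K := Nat.le_of_succ_le hj
  set N : ℝ := ((L : ℝ) ^ j) ^ (d + 1) with hN
  have hN0 : 0 < N := by positivity
  have hw : ∀ i, 0 < w i := fun i => lt_of_lt_of_le (by positivity) (hw0 i)
  have hρ : IsPseudoDist (fun t t' : Site (⟨d + 1, L, m, K, hd, hL⟩ : Params) j => torusSupNorm (Mk (⟨d + 1, L, m, K, hd, hL⟩ : Params) j) (rep (Mk (⟨d + 1, L, m, K, hd, hL⟩ : Params) j) t - rep (Mk (⟨d + 1, L, m, K, hd, hL⟩ : Params) j) t')) := torusDist_isPseudoDist (Mk (⟨d + 1, L, m, K, hd, hL⟩ : Params) j)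
  have hK : SumBound (fun t t' : Site (⟨d + 1, L, m, K, hd, hL⟩ : Params) j => torusSupNorm (Mk (⟨d + 1, L, m, K, hd, hL⟩ : Params) j) (rep (Mk (⟨d + 1, L, m, K, hd, hL⟩ : Params) j) t - rep (Mk (⟨d + 1, L, m, K, hd, hL⟩ : Params) j) t')) (fun a => latticeConst (d + 1) a) := torusDist_sumBound (Mk (⟨d + 1, L, m, K, hd, hL⟩ : Params) j)
  have hKY : ∀ t : ℝ, 0 < t → 0 ≤ latticeConst (d + 1) t := fun t ht => latticeConst_nonneg _ ht.le
  -- at `c = L^j`: `κ = N = n^{d+1}` and `η^{d+1} = N⁻¹`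
  have hκN : ((L : ℝ) ^ j) ^ 2 / (eta L j ^ (d + 1) * ((L : ℝ) ^ j) ^ 2) = N := by
    rw [hN, eta, inv_pow, div_eq_iff (by positivity)]
    field_simp
  have hηN : ((⟨d + 1, L, m, K, hd, hL⟩ : Params)).eta j ^ (d + 1) = N⁻¹ := by
    rw [hN, Params.eta, ← inv_pow, ← inv_pow]
  -- the factor bounds at the common rate `δ₀`
  have hQ : ∀ (b₀ : PBond (⟨d + 1, L, m, K, hd, hL⟩ : Params) 0) (y' : Site (⟨d + 1, L, m, K, hd, hL⟩ : Params) j),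
      ∑ b ∈ univ.filter (fun b : PBond (⟨d + 1, L, m, K, hd, hL⟩ : Params) j => b.src = y'), |LinearMap.adjoint (tsV1 hc Λ' w).Qv (EuclideanSpace.single b (1 : ℝ)) b₀| ≤
        N⁻¹ * Real.exp δ₀ * Real.exp (-(δ₀ * torusSupNorm (Mk (⟨d + 1, L, m, K, hd, hL⟩ : Params) j) (rep (Mk (⟨d + 1, L, m, K, hd, hL⟩ : Params) j) (iterBlockOf j b₀.src) - rep (Mk (⟨d + 1, L, m, K, hd, hL⟩ : Params) j) y'))) := by
    intro b₀ y'
    have h := blockBound_Qv_adjoint hc hj' Λ' w hδ₀0.le b₀ y'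
    rwa [hηN] at h
  have hQv : ∀ (b : PBond (⟨d + 1, L, m, K, hd, hL⟩ : Params) j) (y' : Site (⟨d + 1, L, m, K, hd, hL⟩ : Params) j),
      ∑ b₀ ∈ univ.filter (fun b₀ : PBond (⟨d + 1, L, m, K, hd, hL⟩ : Params) 0 => iterBlockOf j b₀.src = y'), |(tsV1 hc Λ' w).Qv (EuclideanSpace.single b₀ (1 : ℝ)) b| ≤
        Real.exp δ₀ * Real.exp (-(δ₀ * torusSupNorm (Mk (⟨d + 1, L, m, K, hd, hL⟩ : Params) j) (rep (Mk (⟨d + 1, L, m, K, hd, hL⟩ : Params) j) b.src - rep (Mk (⟨d + 1, L, m, K, hd, hL⟩ : Params) j) y'))) := fun b y' => blockBound_Qv hc hj' Λ' w hδ₀0.le b y'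
  have hE : ∀ (b : PBond (⟨d + 1, L, m, K, hd, hL⟩ : Params) j) (y' : Site (⟨d + 1, L, m, K, hd, hL⟩ : Params) j),
      ∑ b' ∈ univ.filter (fun b' : PBond (⟨d + 1, L, m, K, hd, hL⟩ : Params) j => b'.src = y'), |((tsV1 hc Λ' w).Δj + (1 * ((L : ℝ) ^ j) ^ (d + 1)) • (LinearMap.id : UBond (⟨d + 1, L, m, K, hd, hL⟩ : Params) j →ₗ[ℝ] UBond (⟨d + 1, L, m, K, hd, hL⟩ : Params) j)) (EuclideanSpace.single b' (1 : ℝ)) b| ≤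
        N * (AΔ * ((1 * (d + 1) : ℕ) : ℝ) + 1) * Real.exp (-(δ₀ * torusSupNorm (Mk (⟨d + 1, L, m, K, hd, hL⟩ : Params) j) (rep (Mk (⟨d + 1, L, m, K, hd, hL⟩ : Params) j) b.src - rep (Mk (⟨d + 1, L, m, K, hd, hL⟩ : Params) j) y'))) := by
    intro b y'
    have hΔ : ∀ (b : PBond (⟨d + 1, L, m, K, hd, hL⟩ : Params) j) (y' : Site (⟨d + 1, L, m, K, hd, hL⟩ : Params) j),
        ∑ b' ∈ univ.filter (fun b' : PBond (⟨d + 1, L, m, K, hd, hL⟩ : Params) j => b'.src = y'), |(tsV1 hc Λ' w).Δj (EuclideanSpace.single b' (1 : ℝ)) b| ≤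
          N * AΔ * ((1 * (d + 1) : ℕ) : ℝ) * Real.exp (-(κΔ * torusSupNorm (Mk (⟨d + 1, L, m, K, hd, hL⟩ : Params) j) (rep (Mk (⟨d + 1, L, m, K, hd, hL⟩ : Params) j) b.src - rep (Mk (⟨d + 1, L, m, K, hd, hL⟩ : Params) j) y'))) := by
      intro b y'
      have h := blockBound_Δj hc hj Λ' hw b y'
      rwa [hκN] at h
    have hI : ∀ (b : PBond (⟨d + 1, L, m, K, hd, hL⟩ : Params) j) (y' : Site (⟨d + 1, L, m, K, hd, hL⟩ : Params) j),
        ∑ b' ∈ univ.filter (fun b' : PBond (⟨d + 1, L, m, K, hd, hL⟩ : Params) j => b'.src = y'),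
            |((1 * ((L : ℝ) ^ j) ^ (d + 1)) • (LinearMap.id : UBond (⟨d + 1, L, m, K, hd, hL⟩ : Params) j →ₗ[ℝ] UBond (⟨d + 1, L, m, K, hd, hL⟩ : Params) j)) (EuclideanSpace.single b' (1 : ℝ)) b| ≤
          |1 * ((L : ℝ) ^ j) ^ (d + 1)| * 1 * Real.exp (-(κΔ * torusSupNorm (Mk (⟨d + 1, L, m, K, hd, hL⟩ : Params) j) (rep (Mk (⟨d + 1, L, m, K, hd, hL⟩ : Params) j) b.src - rep (Mk (⟨d + 1, L, m, K, hd, hL⟩ : Params) j) y'))) :=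
      fun b y' => blockBound_smul (ρ := (fun t t' : Site (⟨d + 1, L, m, K, hd, hL⟩ : Params) j => torusSupNorm (Mk (⟨d + 1, L, m, K, hd, hL⟩ : Params) j) (rep (Mk (⟨d + 1, L, m, K, hd, hL⟩ : Params) j) t - rep (Mk (⟨d + 1, L, m, K, hd, hL⟩ : Params) j) t'))) _ (fun b : PBond (⟨d + 1, L, m, K, hd, hL⟩ : Params) j => b.src) (fun b : PBond (⟨d + 1, L, m, K, hd, hL⟩ : Params) j => b.src) _ (fun b y' => blockBound_id hρ (fun b : PBond (⟨d + 1, L, m, K, hd, hL⟩ : Params) j => b.src) κΔ b y') b y'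
    have h := blockBound_add (ρ := (fun t t' : Site (⟨d + 1, L, m, K, hd, hL⟩ : Params) j => torusSupNorm (Mk (⟨d + 1, L, m, K, hd, hL⟩ : Params) j) (rep (Mk (⟨d + 1, L, m, K, hd, hL⟩ : Params) j) t - rep (Mk (⟨d + 1, L, m, K, hd, hL⟩ : Params) j) t'))) _ _ (fun b : PBond (⟨d + 1, L, m, K, hd, hL⟩ : Params) j => b.src) (fun b : PBond (⟨d + 1, L, m, K, hd, hL⟩ : Params) j => b.src) hΔ hI
    have h' := blockBound_mono hρ ((tsV1 hc Λ' w).Δj + (1 * ((L : ℝ) ^ j) ^ (d + 1)) • (LinearMap.id : UBond (⟨d + 1, L, m, K, hd, hL⟩ : Params) j →ₗ[ℝ] UBond (⟨d + 1, L, m, K, hd, hL⟩ : Params) j)) (fun b : PBond (⟨d + 1, L, m, K, hd, hL⟩ : Params) j => b.src) (fun b : PBond (⟨d + 1, L, m, K, hd, hL⟩ : Params) j => b.src) (C' := N * (AΔ * ((1 * (d + 1) : ℕ) : ℝ) + 1)) (by positivity)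
      (le_of_eq (by rw [abs_of_pos hw', hN]; ring)) hδ₀Δ h
    exact h' b y'
  have hGb := blockBound_mono hρ (GE (Domains.whole (P := (⟨d + 1, L, m, K, hd, hL⟩ : Params)) j (Nat.le_of_succ_le hj)) hc (w := fun _ => 1 * ((L : ℝ) ^ j) ^ (d + 1)) (fun _ => hw')) (fun b₀ : PBond (⟨d + 1, L, m, K, hd, hL⟩ : Params) 0 => iterBlockOf j b₀.src) (fun b₀ : PBond (⟨d + 1, L, m, K, hd, hL⟩ : Params) 0 => iterBlockOf j b₀.src) hCG le_rfl hδ₀G (hG m K j hj' hc hw')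
  have h := blockBound_comp4r hρ hK (GE (Domains.whole (P := (⟨d + 1, L, m, K, hd, hL⟩ : Params)) j (Nat.le_of_succ_le hj)) hc (w := fun _ => 1 * ((L : ℝ) ^ j) ^ (d + 1)) (fun _ => hw')) (LinearMap.adjoint (tsV1 hc Λ' w).Qv) ((tsV1 hc Λ' w).Δj + (1 * ((L : ℝ) ^ j) ^ (d + 1)) • (LinearMap.id : UBond (⟨d + 1, L, m, K, hd, hL⟩ : Params) j →ₗ[ℝ] UBond (⟨d + 1, L, m, K, hd, hL⟩ : Params) j)) (tsV1 hc Λ' w).Qv (fun b₀ : PBond (⟨d + 1, L, m, K, hd, hL⟩ : Params) 0 => iterBlockOf j b₀.src) (fun b₀ : PBond (⟨d + 1, L, m, K, hd, hL⟩ : Params) 0 => iterBlockOf j b₀.src) (fun b : PBond (⟨d + 1, L, m, K, hd, hL⟩ : Params) j => b.src) (fun b : PBond (⟨d + 1, L, m, K, hd, hL⟩ : Params) j => b.src) (fun b₀ : PBond (⟨d + 1, L, m, K, hd, hL⟩ : Params) 0 => iterBlockOf j b₀.src)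
    hCG (by positivity) (by positivity) (by positivity) hδ₀0 hKY hGb hQ hE hQv b₀ y
  refine h.trans (le_of_eq ?_)
  rw [hC, hK₁, hK₂, hK₃]
  field_simp

open Classical in
/-- **`H_jC̃(Δ_j + w′)Q_j` HAS A UNIFORM BLOCK BOUND** (the adjoint of `Q_j*(Δ_j + w′)C̃H_j*`): `H_j` `(A_H(d+1), κ_H)` (file 5). [cite: Balaban1984PropagatorsII, (2.129)–(2.131) p.246] -/
theorem blockBound_Y2adj_scaling (d L : ℕ) (hd : 1 ≤ d + 1) (hL : Odd L ∧ 1 < L) {a₀ a₁ : ℝ} (ha₀ : 0 < a₀) (ha₁ : a₀ ≤ a₁) :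
    ∃ δ : ℝ, 0 < δ ∧ ∃ C : ℝ, 0 ≤ C ∧ ∀ (m K : ℕ) (j : ℕ) (hc : ((L : ℝ) ^ j) ≠ 0)
      (hj : j + 1 ≤ (⟨d + 1, L, m, K, hd, hL⟩ : Params).m + (⟨d + 1, L, m, K, hd, hL⟩ : Params).K)
      (Λ' : Finset (Site (⟨d + 1, L, m, K, hd, hL⟩ : Params) (j + 1))) (w : CIdx j Λ' → ℝ)
      (hw0 : ∀ i, a₀ * ((L : ℝ) ^ j) ^ (d + 1) ≤ w i) (hw1 : ∀ i, w i ≤ a₁ * ((L : ℝ) ^ j) ^ (d + 1))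
      (hw' : (0 : ℝ) < 1 * ((L : ℝ) ^ j) ^ (d + 1))
      (b₀ : PBond (⟨d + 1, L, m, K, hd, hL⟩ : Params) 0) (y : Site (⟨d + 1, L, m, K, hd, hL⟩ : Params) j),
      ∑ b₀' ∈ univ.filter (fun b₀' : PBond (⟨d + 1, L, m, K, hd, hL⟩ : Params) 0 => iterBlockOf j b₀'.src = y),
          |((tsV1 hc Λ' w).Hj ∘ₗ (tsV1 hc Λ' w).Ct ∘ₗ ((tsV1 hc Λ' w).Δj + (1 * ((L : ℝ) ^ j) ^ (d + 1)) • (LinearMap.id : UBond (⟨d + 1, L, m, K, hd, hL⟩ : Params) j →ₗ[ℝ] UBond (⟨d + 1, L, m, K, hd, hL⟩ : Params) j)) ∘ₗ (tsV1 hc Λ' w).Qv) (EuclideanSpace.single b₀' (1 : ℝ)) b₀| ≤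
        C * Real.exp (-(δ * torusSupNorm (Mk (⟨d + 1, L, m, K, hd, hL⟩ : Params) j) (rep (Mk (⟨d + 1, L, m, K, hd, hL⟩ : Params) j) (iterBlockOf j b₀.src) - rep (Mk (⟨d + 1, L, m, K, hd, hL⟩ : Params) j) y))) := by
  obtain ⟨δG, hδG, CG, hCG, hG⟩ := blockBound_GE_scaling d L hd hL one_pos
  obtain ⟨δC, hδC, ECt, hECt, hCt⟩ := blockBound_Ct_scaling d L hd hL ha₀ ha₁
  set κΔ : ℝ := kappa166 (d + 1) / (d + 1) with hκΔ
  have hκΔ0 : 0 < κΔ := div_pos (kappa166_pos _) (by positivity)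
  set κH : ℝ := kappa163 (d + 1) / ((d : ℝ) + 1) with hκH
  have hκH0 : 0 < κH := div_pos (kappa163_pos _) (by positivity)
  set δ₀ : ℝ := min (min κΔ δG) (min δC κH) with hδ₀
  have hδ₀0 : 0 < δ₀ := lt_min (lt_min hκΔ0 hδG) (lt_min hδC hκH0)
  have hδ₀Δ : δ₀ ≤ κΔ := (min_le_left _ _).trans (min_le_left _ _)
  have hδ₀G : δ₀ ≤ δG := (min_le_left _ _).trans (min_le_right _ _)
  have hδ₀C : δ₀ ≤ δC := (min_le_right _ _).trans (min_le_left _ _)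
  have hδ₀H : δ₀ ≤ κH := (min_le_right _ _).trans (min_le_right _ _)
  set AΔ : ℝ := MC (d + 1) (kappa166 (d + 1)) * periodConst (kappa166 (d + 1)) d with hAΔ
  have hAΔ0 : 0 ≤ AΔ := ADelta_nonneg d
  set AH : ℝ := MG163 (d + 1) * periodConst (kappa163 (d + 1)) d with hAH
  have hAH0 : 0 ≤ AH := mul_nonneg (MG163_nonneg _) (periodConst_pos (kappa163_pos _) _).le
  set K₁ : ℝ := latticeConst (d + 1) (δ₀ - δ₀ / 2) with hK₁
  set K₂ : ℝ := latticeConst (d + 1) (δ₀ - δ₀ / 4) with hK₂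
  set K₃ : ℝ := latticeConst (d + 1) (δ₀ - δ₀ / 8) with hK₃
  have hK₁0 : 0 ≤ K₁ := latticeConst_nonneg _ (by linarith)
  have hK₂0 : 0 ≤ K₂ := latticeConst_nonneg _ (by linarith)
  have hK₃0 : 0 ≤ K₃ := latticeConst_nonneg _ (by linarith)
  have hL0 : 0 < L := by have := hL.2; omega
  haveI : NeZero L := ⟨by omega⟩
  have hLp : (0 : ℝ) < L := by exact_mod_cast hL0
  set C : ℝ := AH * ((1 * (d + 1) : ℕ) : ℝ) * (ECt * ((AΔ * ((1 * (d + 1) : ℕ) : ℝ) + 1) * Real.exp δ₀ * K₁) * K₂) * K₃ with hC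
  have hC0 : 0 ≤ C := by positivity
  refine ⟨δ₀ / 8, by positivity, C, hC0, ?_⟩
  intro m K j hc hj Λ' w hw0 hw1 hw' b₀ y
  have hj' : j ≤ m + K := Nat.le_of_succ_le hj
  set N : ℝ := ((L : ℝ) ^ j) ^ (d + 1) with hN
  have hN0 : 0 < N := by positivity
  have hw : ∀ i, 0 < w i := fun i => lt_of_lt_of_le (by positivity) (hw0 i)
  have hρ : IsPseudoDist (fun t t' : Site (⟨d + 1, L, m, K, hd, hL⟩ : Params) j => torusSupNorm (Mk (⟨d + 1, L, m, K, hd, hL⟩ : Params) j) (rep (Mk (⟨d + 1, L, m, K, hd, hL⟩ : Params) j) t - rep (Mk (⟨d + 1, L, m, K, hd, hL⟩ : Params) j) t')) := torusDist_isPseudoDist (Mk (⟨d + 1, L, m, K, hd, hL⟩ : Params) j)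
  have hK : SumBound (fun t t' : Site (⟨d + 1, L, m, K, hd, hL⟩ : Params) j => torusSupNorm (Mk (⟨d + 1, L, m, K, hd, hL⟩ : Params) j) (rep (Mk (⟨d + 1, L, m, K, hd, hL⟩ : Params) j) t - rep (Mk (⟨d + 1, L, m, K, hd, hL⟩ : Params) j) t')) (fun a => latticeConst (d + 1) a) := torusDist_sumBound (Mk (⟨d + 1, L, m, K, hd, hL⟩ : Params) j)
  have hKY : ∀ t : ℝ, 0 < t → 0 ≤ latticeConst (d + 1) t := fun t ht => latticeConst_nonneg _ ht.le
  -- at `c = L^j`: `κ = N = n^{d+1}` and `η^{d+1} = N⁻¹`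
  have hκN : ((L : ℝ) ^ j) ^ 2 / (eta L j ^ (d + 1) * ((L : ℝ) ^ j) ^ 2) = N := by
    rw [hN, eta, inv_pow, div_eq_iff (by positivity)]
    field_simp
  have hηN : ((⟨d + 1, L, m, K, hd, hL⟩ : Params)).eta j ^ (d + 1) = N⁻¹ := by
    rw [hN, Params.eta, ← inv_pow, ← inv_pow]
  -- the factor bounds at the common rate `δ₀`
  have hQ : ∀ (b₀ : PBond (⟨d + 1, L, m, K, hd, hL⟩ : Params) 0) (y' : Site (⟨d + 1, L, m, K, hd, hL⟩ : Params) j),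
      ∑ b ∈ univ.filter (fun b : PBond (⟨d + 1, L, m, K, hd, hL⟩ : Params) j => b.src = y'), |LinearMap.adjoint (tsV1 hc Λ' w).Qv (EuclideanSpace.single b (1 : ℝ)) b₀| ≤
        N⁻¹ * Real.exp δ₀ * Real.exp (-(δ₀ * torusSupNorm (Mk (⟨d + 1, L, m, K, hd, hL⟩ : Params) j) (rep (Mk (⟨d + 1, L, m, K, hd, hL⟩ : Params) j) (iterBlockOf j b₀.src) - rep (Mk (⟨d + 1, L, m, K, hd, hL⟩ : Params) j) y'))) := by
    intro b₀ y'
    have h := blockBound_Qv_adjoint hc hj' Λ' w hδ₀0.le b₀ y'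
    rwa [hηN] at h
  have hQv : ∀ (b : PBond (⟨d + 1, L, m, K, hd, hL⟩ : Params) j) (y' : Site (⟨d + 1, L, m, K, hd, hL⟩ : Params) j),
      ∑ b₀ ∈ univ.filter (fun b₀ : PBond (⟨d + 1, L, m, K, hd, hL⟩ : Params) 0 => iterBlockOf j b₀.src = y'), |(tsV1 hc Λ' w).Qv (EuclideanSpace.single b₀ (1 : ℝ)) b| ≤
        Real.exp δ₀ * Real.exp (-(δ₀ * torusSupNorm (Mk (⟨d + 1, L, m, K, hd, hL⟩ : Params) j) (rep (Mk (⟨d + 1, L, m, K, hd, hL⟩ : Params) j) b.src - rep (Mk (⟨d + 1, L, m, K, hd, hL⟩ : Params) j) y'))) := fun b y' => blockBound_Qv hc hj' Λ' w hδ₀0.le b y'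
  have hE : ∀ (b : PBond (⟨d + 1, L, m, K, hd, hL⟩ : Params) j) (y' : Site (⟨d + 1, L, m, K, hd, hL⟩ : Params) j),
      ∑ b' ∈ univ.filter (fun b' : PBond (⟨d + 1, L, m, K, hd, hL⟩ : Params) j => b'.src = y'), |((tsV1 hc Λ' w).Δj + (1 * ((L : ℝ) ^ j) ^ (d + 1)) • (LinearMap.id : UBond (⟨d + 1, L, m, K, hd, hL⟩ : Params) j →ₗ[ℝ] UBond (⟨d + 1, L, m, K, hd, hL⟩ : Params) j)) (EuclideanSpace.single b' (1 : ℝ)) b| ≤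
        N * (AΔ * ((1 * (d + 1) : ℕ) : ℝ) + 1) * Real.exp (-(δ₀ * torusSupNorm (Mk (⟨d + 1, L, m, K, hd, hL⟩ : Params) j) (rep (Mk (⟨d + 1, L, m, K, hd, hL⟩ : Params) j) b.src - rep (Mk (⟨d + 1, L, m, K, hd, hL⟩ : Params) j) y'))) := by
    intro b y'
    have hΔ : ∀ (b : PBond (⟨d + 1, L, m, K, hd, hL⟩ : Params) j) (y' : Site (⟨d + 1, L, m, K, hd, hL⟩ : Params) j),
        ∑ b' ∈ univ.filter (fun b' : PBond (⟨d + 1, L, m, K, hd, hL⟩ : Params) j => b'.src = y'), |(tsV1 hc Λ' w).Δj (EuclideanSpace.single b' (1 : ℝ)) b| ≤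
          N * AΔ * ((1 * (d + 1) : ℕ) : ℝ) * Real.exp (-(κΔ * torusSupNorm (Mk (⟨d + 1, L, m, K, hd, hL⟩ : Params) j) (rep (Mk (⟨d + 1, L, m, K, hd, hL⟩ : Params) j) b.src - rep (Mk (⟨d + 1, L, m, K, hd, hL⟩ : Params) j) y'))) := by
      intro b y'
      have h := blockBound_Δj hc hj Λ' hw b y'
      rwa [hκN] at h
    have hI : ∀ (b : PBond (⟨d + 1, L, m, K, hd, hL⟩ : Params) j) (y' : Site (⟨d + 1, L, m, K, hd, hL⟩ : Params) j),
        ∑ b' ∈ univ.filter (fun b' : PBond (⟨d + 1, L, m, K, hd, hL⟩ : Params) j => b'.src = y'),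
            |((1 * ((L : ℝ) ^ j) ^ (d + 1)) • (LinearMap.id : UBond (⟨d + 1, L, m, K, hd, hL⟩ : Params) j →ₗ[ℝ] UBond (⟨d + 1, L, m, K, hd, hL⟩ : Params) j)) (EuclideanSpace.single b' (1 : ℝ)) b| ≤
          |1 * ((L : ℝ) ^ j) ^ (d + 1)| * 1 * Real.exp (-(κΔ * torusSupNorm (Mk (⟨d + 1, L, m, K, hd, hL⟩ : Params) j) (rep (Mk (⟨d + 1, L, m, K, hd, hL⟩ : Params) j) b.src - rep (Mk (⟨d + 1, L, m, K, hd, hL⟩ : Params) j) y'))) :=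
      fun b y' => blockBound_smul (ρ := (fun t t' : Site (⟨d + 1, L, m, K, hd, hL⟩ : Params) j => torusSupNorm (Mk (⟨d + 1, L, m, K, hd, hL⟩ : Params) j) (rep (Mk (⟨d + 1, L, m, K, hd, hL⟩ : Params) j) t - rep (Mk (⟨d + 1, L, m, K, hd, hL⟩ : Params) j) t'))) _ (fun b : PBond (⟨d + 1, L, m, K, hd, hL⟩ : Params) j => b.src) (fun b : PBond (⟨d + 1, L, m, K, hd, hL⟩ : Params) j => b.src) _ (fun b y' => blockBound_id hρ (fun b : PBond (⟨d + 1, L, m, K, hd, hL⟩ : Params) j => b.src) κΔ b y') b y'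
    have h := blockBound_add (ρ := (fun t t' : Site (⟨d + 1, L, m, K, hd, hL⟩ : Params) j => torusSupNorm (Mk (⟨d + 1, L, m, K, hd, hL⟩ : Params) j) (rep (Mk (⟨d + 1, L, m, K, hd, hL⟩ : Params) j) t - rep (Mk (⟨d + 1, L, m, K, hd, hL⟩ : Params) j) t'))) _ _ (fun b : PBond (⟨d + 1, L, m, K, hd, hL⟩ : Params) j => b.src) (fun b : PBond (⟨d + 1, L, m, K, hd, hL⟩ : Params) j => b.src) hΔ hI
    have h' := blockBound_mono hρ ((tsV1 hc Λ' w).Δj + (1 * ((L : ℝ) ^ j) ^ (d + 1)) • (LinearMap.id : UBond (⟨d + 1, L, m, K, hd, hL⟩ : Params) j →ₗ[ℝ] UBond (⟨d + 1, L, m, K, hd, hL⟩ : Params) j)) (fun b : PBond (⟨d + 1, L, m, K, hd, hL⟩ : Params) j => b.src) (fun b : PBond (⟨d + 1, L, m, K, hd, hL⟩ : Params) j => b.src) (C' := N * (AΔ * ((1 * (d + 1) : ℕ) : ℝ) + 1)) (by positivity)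
      (le_of_eq (by rw [abs_of_pos hw', hN]; ring)) hδ₀Δ h
    exact h' b y'
  have hCtb : ∀ (b : PBond (⟨d + 1, L, m, K, hd, hL⟩ : Params) j) (y' : Site (⟨d + 1, L, m, K, hd, hL⟩ : Params) j),
      ∑ b' ∈ univ.filter (fun b' : PBond (⟨d + 1, L, m, K, hd, hL⟩ : Params) j => b'.src = y'), |(tsV1 hc Λ' w).Ct (EuclideanSpace.single b' (1 : ℝ)) b| ≤
        ECt / N * Real.exp (-(δ₀ * torusSupNorm (Mk (⟨d + 1, L, m, K, hd, hL⟩ : Params) j) (rep (Mk (⟨d + 1, L, m, K, hd, hL⟩ : Params) j) b.src - rep (Mk (⟨d + 1, L, m, K, hd, hL⟩ : Params) j) y'))) :=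
    blockBound_mono hρ (tsV1 hc Λ' w).Ct (fun b : PBond (⟨d + 1, L, m, K, hd, hL⟩ : Params) j => b.src) (fun b : PBond (⟨d + 1, L, m, K, hd, hL⟩ : Params) j => b.src) (by positivity) le_rfl hδ₀C (hCt m K j hc hj Λ' w hw0 hw1)
  have hHb : ∀ (b₀ : PBond (⟨d + 1, L, m, K, hd, hL⟩ : Params) 0) (y' : Site (⟨d + 1, L, m, K, hd, hL⟩ : Params) j),
      ∑ b ∈ univ.filter (fun b : PBond (⟨d + 1, L, m, K, hd, hL⟩ : Params) j => b.src = y'), |(tsV1 hc Λ' w).Hj (EuclideanSpace.single b (1 : ℝ)) b₀| ≤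
        AH * ((1 * (d + 1) : ℕ) : ℝ) * Real.exp (-(δ₀ * torusSupNorm (Mk (⟨d + 1, L, m, K, hd, hL⟩ : Params) j) (rep (Mk (⟨d + 1, L, m, K, hd, hL⟩ : Params) j) (iterBlockOf j b₀.src) - rep (Mk (⟨d + 1, L, m, K, hd, hL⟩ : Params) j) y'))) :=
    blockBound_mono hρ (tsV1 hc Λ' w).Hj (fun b₀ : PBond (⟨d + 1, L, m, K, hd, hL⟩ : Params) 0 => iterBlockOf j b₀.src) (fun b : PBond (⟨d + 1, L, m, K, hd, hL⟩ : Params) j => b.src) (by positivity) le_rfl hδ₀H (fun b₀ y' => blockBound_Hj hc hj Λ' hw b₀ y')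
  have h := blockBound_comp4r hρ hK (tsV1 hc Λ' w).Hj (tsV1 hc Λ' w).Ct ((tsV1 hc Λ' w).Δj + (1 * ((L : ℝ) ^ j) ^ (d + 1)) • (LinearMap.id : UBond (⟨d + 1, L, m, K, hd, hL⟩ : Params) j →ₗ[ℝ] UBond (⟨d + 1, L, m, K, hd, hL⟩ : Params) j)) (tsV1 hc Λ' w).Qv (fun b₀ : PBond (⟨d + 1, L, m, K, hd, hL⟩ : Params) 0 => iterBlockOf j b₀.src) (fun b : PBond (⟨d + 1, L, m, K, hd, hL⟩ : Params) j => b.src) (fun b : PBond (⟨d + 1, L, m, K, hd, hL⟩ : Params) j => b.src) (fun b : PBond (⟨d + 1, L, m, K, hd, hL⟩ : Params) j => b.src) (fun b₀ : PBond (⟨d + 1, L, m, K, hd, hL⟩ : Params) 0 => iterBlockOf j b₀.src)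
    (by positivity) (by positivity) (by positivity) (by positivity) hδ₀0 hKY hHb hCtb hE hQv b₀ y
  refine h.trans (le_of_eq ?_)
  rw [hC, hK₁, hK₂, hK₃]
  field_simp

end Products

/-! ## §4  `R₀`, `M`, `K₂`: uniform rows, columns and `ℓ²`-block bounds -/

section L2

open Classical in
/-- **`R₀ = I − Q_j*(Δ_j + w′)Q_jG^{(w′)} + Q_j*(Δ_j + w′)C̃H_j*` HAS A UNIFORM ROW BLOCK BOUND** (§3 and the identity).
[cite: Balaban1984PropagatorsII, (2.129)–(2.131) p.246] -/
theorem blockBound_R0_scaling (d L : ℕ) (hd : 1 ≤ d + 1) (hL : Odd L ∧ 1 < L) {a₀ a₁ : ℝ} (ha₀ : 0 < a₀) (ha₁ : a₀ ≤ a₁) :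
    ∃ δ : ℝ, 0 < δ ∧ ∃ C : ℝ, 0 ≤ C ∧ ∀ (m K : ℕ) (j : ℕ) (hc : ((L : ℝ) ^ j) ≠ 0)
      (hj : j + 1 ≤ (⟨d + 1, L, m, K, hd, hL⟩ : Params).m + (⟨d + 1, L, m, K, hd, hL⟩ : Params).K)
      (Λ' : Finset (Site (⟨d + 1, L, m, K, hd, hL⟩ : Params) (j + 1))) (w : CIdx j Λ' → ℝ)
      (hw0 : ∀ i, a₀ * ((L : ℝ) ^ j) ^ (d + 1) ≤ w i) (hw1 : ∀ i, w i ≤ a₁ * ((L : ℝ) ^ j) ^ (d + 1))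
      (hw' : (0 : ℝ) < 1 * ((L : ℝ) ^ j) ^ (d + 1))
      (b₀ : PBond (⟨d + 1, L, m, K, hd, hL⟩ : Params) 0) (y : Site (⟨d + 1, L, m, K, hd, hL⟩ : Params) j),
      ∑ b₀' ∈ univ.filter (fun b₀' : PBond (⟨d + 1, L, m, K, hd, hL⟩ : Params) 0 => iterBlockOf j b₀'.src = y),
          |(((LinearMap.id - LinearMap.adjoint (tsV1 hc Λ' w).Qv ∘ₗ ((tsV1 hc Λ' w).Δj + (1 * ((L : ℝ) ^ j) ^ (d + 1)) • (LinearMap.id : UBond (⟨d + 1, L, m, K, hd, hL⟩ : Params) j →ₗ[ℝ] UBond (⟨d + 1, L, m, K, hd, hL⟩ : Params) j)) ∘ₗ (tsV1 hc Λ' w).Qv ∘ₗ (GE (Domains.whole (P := (⟨d + 1, L, m, K, hd, hL⟩ : Params)) j (Nat.le_of_succ_le hj)) hc (w := fun _ => 1 * ((L : ℝ) ^ j) ^ (d + 1)) (fun _ => hw')) + LinearMap.adjoint (tsV1 hc Λ' w).Qv ∘ₗ ((tsV1 hc Λ' w).Δj + (1 * ((L : ℝ) ^ j) ^ (d + 1))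 • (LinearMap.id : UBond (⟨d + 1, L, m, K, hd, hL⟩ : Params) j →ₗ[ℝ] UBond (⟨d + 1, L, m, K, hd, hL⟩ : Params) j)) ∘ₗ (tsV1 hc Λ' w).Ct ∘ₗ LinearMap.adjoint (tsV1 hc Λ' w).Hj : BondSpace (⟨d + 1, L, m, K, hd, hL⟩ : Params) →ₗ[ℝ] BondSpace (⟨d + 1, L, m, K, hd, hL⟩ : Params)))) (EuclideanSpace.single b₀' (1 : ℝ)) b₀| ≤
        C * Real.exp (-(δ * torusSupNorm (Mk (⟨d + 1, L, m, K, hd, hL⟩ : Params) j) (rep (Mk (⟨d + 1, L, m, K, hd, hL⟩ : Params) j) (iterBlockOf j b₀.src) - rep (Mk (⟨d + 1, L, m, K, hd, hL⟩ : Params) j) y))) := by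
  obtain ⟨δ₁, hδ₁, C₁, hC₁, h1⟩ := blockBound_Y1_scaling d L hd hL ha₀ ha₁
  obtain ⟨δ₂, hδ₂, C₂, hC₂, h2⟩ := blockBound_Y2_scaling d L hd hL ha₀ ha₁
  refine ⟨min δ₁ δ₂, lt_min hδ₁ hδ₂, 1 + C₁ + C₂, by positivity, ?_⟩
  intro m K j hc hj Λ' w hw0 hw1 hw' b₀ y
  have hρ : IsPseudoDist (fun t t' : Site (⟨d + 1, L, m, K, hd, hL⟩ : Params) j => torusSupNorm (Mk (⟨d + 1, L, m, K, hd, hL⟩ : Params) j) (rep (Mk (⟨d + 1, L, m, K, hd, hL⟩ : Params) j) t - rep (Mk (⟨d + 1, L, m, K, hd, hL⟩ : Params) j) t')) := torusDist_isPseudoDist (Mk (⟨d + 1, L, m, K, hd, hL⟩ : Params) j)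
  have b1 := blockBound_mono hρ (LinearMap.adjoint (tsV1 hc Λ' w).Qv ∘ₗ ((tsV1 hc Λ' w).Δj + (1 * ((L : ℝ) ^ j) ^ (d + 1)) • (LinearMap.id : UBond (⟨d + 1, L, m, K, hd, hL⟩ : Params) j →ₗ[ℝ] UBond (⟨d + 1, L, m, K, hd, hL⟩ : Params) j)) ∘ₗ (tsV1 hc Λ' w).Qv ∘ₗ (GE (Domains.whole (P := (⟨d + 1, L, m, K, hd, hL⟩ : Params)) j (Nat.le_of_succ_le hj)) hc (w := fun _ => 1 * ((L : ℝ) ^ j) ^ (d + 1)) (fun _ => hw'))) (fun b₀ : PBond (⟨d + 1, L, m, K, hd, hL⟩ : Params) 0 => iterBlockOf j b₀.src) (fun b₀ : PBond (⟨d + 1, L, m, K, hd, hL⟩ : Params) 0 => iterBlockOf j b₀.src) hC₁ le_rfl (min_le_left δ₁ δ₂) (h1 m K j hc hj Λ' w hw0 hw1 hw')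
  have b2 := blockBound_mono hρ (LinearMap.adjoint (tsV1 hc Λ' w).Qv ∘ₗ ((tsV1 hc Λ' w).Δj + (1 * ((L : ℝ) ^ j) ^ (d + 1)) • (LinearMap.id : UBond (⟨d + 1, L, m, K, hd, hL⟩ : Params) j →ₗ[ℝ] UBond (⟨d + 1, L, m, K, hd, hL⟩ : Params) j)) ∘ₗ (tsV1 hc Λ' w).Ct ∘ₗ LinearMap.adjoint (tsV1 hc Λ' w).Hj) (fun b₀ : PBond (⟨d + 1, L, m, K, hd, hL⟩ : Params) 0 => iterBlockOf j b₀.src) (fun b₀ : PBond (⟨d + 1, L, m, K, hd, hL⟩ : Params) 0 => iterBlockOf j b₀.src) hC₂ le_rfl (min_le_right δ₁ δ₂) (h2 m K j hc hj Λ' w hw0 hw1 hw')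
  have bid := blockBound_id hρ (fun b₀ : PBond (⟨d + 1, L, m, K, hd, hL⟩ : Params) 0 => iterBlockOf j b₀.src) (min δ₁ δ₂)
  have b3 := blockBound_sub (ρ := (fun t t' : Site (⟨d + 1, L, m, K, hd, hL⟩ : Params) j => torusSupNorm (Mk (⟨d + 1, L, m, K, hd, hL⟩ : Params) j) (rep (Mk (⟨d + 1, L, m, K, hd, hL⟩ : Params) j) t - rep (Mk (⟨d + 1, L, m, K, hd, hL⟩ : Params) j) t'))) _ _ (fun b₀ : PBond (⟨d + 1, L, m, K, hd, hL⟩ : Params) 0 => iterBlockOf j b₀.src) (fun b₀ : PBond (⟨d + 1, L, m, K, hd, hL⟩ : Params) 0 => iterBlockOf j b₀.src) bid b1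
  exact blockBound_add (ρ := (fun t t' : Site (⟨d + 1, L, m, K, hd, hL⟩ : Params) j => torusSupNorm (Mk (⟨d + 1, L, m, K, hd, hL⟩ : Params) j) (rep (Mk (⟨d + 1, L, m, K, hd, hL⟩ : Params) j) t - rep (Mk (⟨d + 1, L, m, K, hd, hL⟩ : Params) j) t'))) _ _ (fun b₀ : PBond (⟨d + 1, L, m, K, hd, hL⟩ : Params) 0 => iterBlockOf j b₀.src) (fun b₀ : PBond (⟨d + 1, L, m, K, hd, hL⟩ : Params) 0 => iterBlockOf j b₀.src) b3 b2 b₀ y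

open Classical in
/-- **`R₀*` HAS A UNIFORM ROW BLOCK BOUND** (the column sums of `R₀`; `adjoint_R0_eq` and §3). [cite: Balaban1984PropagatorsII, (2.129)–(2.131) p.246] -/
theorem blockBound_R0adj_scaling (d L : ℕ) (hd : 1 ≤ d + 1) (hL : Odd L ∧ 1 < L) {a₀ a₁ : ℝ} (ha₀ : 0 < a₀) (ha₁ : a₀ ≤ a₁) :
    ∃ δ : ℝ, 0 < δ ∧ ∃ C : ℝ, 0 ≤ C ∧ ∀ (m K : ℕ) (j : ℕ) (hc : ((L : ℝ) ^ j) ≠ 0)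
      (hj : j + 1 ≤ (⟨d + 1, L, m, K, hd, hL⟩ : Params).m + (⟨d + 1, L, m, K, hd, hL⟩ : Params).K)
      (Λ' : Finset (Site (⟨d + 1, L, m, K, hd, hL⟩ : Params) (j + 1))) (w : CIdx j Λ' → ℝ)
      (hw0 : ∀ i, a₀ * ((L : ℝ) ^ j) ^ (d + 1) ≤ w i) (hw1 : ∀ i, w i ≤ a₁ * ((L : ℝ) ^ j) ^ (d + 1))
      (hw' : (0 : ℝ) < 1 * ((L : ℝ) ^ j) ^ (d + 1))
      (b₀ : PBond (⟨d + 1, L, m, K, hd, hL⟩ : Params) 0) (y : Site (⟨d + 1, L, m, K, hd, hL⟩ : Params) j),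
      ∑ b₀' ∈ univ.filter (fun b₀' : PBond (⟨d + 1, L, m, K, hd, hL⟩ : Params) 0 => iterBlockOf j b₀'.src = y),
          |LinearMap.adjoint (((LinearMap.id - LinearMap.adjoint (tsV1 hc Λ' w).Qv ∘ₗ ((tsV1 hc Λ' w).Δj + (1 * ((L : ℝ) ^ j) ^ (d + 1)) • (LinearMap.id : UBond (⟨d + 1, L, m, K, hd, hL⟩ : Params) j →ₗ[ℝ] UBond (⟨d + 1, L, m, K, hd, hL⟩ : Params) j)) ∘ₗ (tsV1 hc Λ' w).Qv ∘ₗ (GE (Domains.whole (P := (⟨d + 1, L, m, K, hd, hL⟩ : Params)) j (Nat.le_of_succ_le hj)) hc (w := fun _ => 1 * ((L : ℝ) ^ j) ^ (d + 1)) (fun _ => hw')) + LinearMap.adjoint (tsV1 hc Λ' w).Qv ∘ₗ ((tsV1 hc Λ' w).Δj + (1 * ((L : ℝ) ^ j) ^ (d + 1)) • (LinearMap.id : UBond (⟨d + 1, L, m, K, hd, hL⟩ : Params) j →ₗ[ℝ] UBond (⟨d + 1, L, m, K, hd, hL⟩ : Params) j)) ∘ₗ (tsV1 hc Λ' w).Ct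 ∘ₗ LinearMap.adjoint (tsV1 hc Λ' w).Hj : BondSpace (⟨d + 1, L, m, K, hd, hL⟩ : Params) →ₗ[ℝ] BondSpace (⟨d + 1, L, m, K, hd, hL⟩ : Params)))) (EuclideanSpace.single b₀' (1 : ℝ)) b₀| ≤
        C * Real.exp (-(δ * torusSupNorm (Mk (⟨d + 1, L, m, K, hd, hL⟩ : Params) j) (rep (Mk (⟨d + 1, L, m, K, hd, hL⟩ : Params) j) (iterBlockOf j b₀.src) - rep (Mk (⟨d + 1, L, m, K, hd, hL⟩ : Params) j) y))) := by
  obtain ⟨δ₁, hδ₁, C₁, hC₁, h1⟩ := blockBound_Y1adj_scaling d L hd hL ha₀ ha₁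
  obtain ⟨δ₂, hδ₂, C₂, hC₂, h2⟩ := blockBound_Y2adj_scaling d L hd hL ha₀ ha₁
  refine ⟨min δ₁ δ₂, lt_min hδ₁ hδ₂, 1 + C₁ + C₂, by positivity, ?_⟩
  intro m K j hc hj Λ' w hw0 hw1 hw' b₀ y
  have hL0 : 0 < L := by have := hL.2; omega
  have hLp : (0 : ℝ) < L := by exact_mod_cast hL0
  have hw : ∀ i, 0 < w i := fun i => lt_of_lt_of_le (by positivity) (hw0 i)
  have hρ : IsPseudoDist (fun t t' : Site (⟨d + 1, L, m, K, hd, hL⟩ : Params) j => torusSupNorm (Mk (⟨d + 1, L, m, K, hd, hL⟩ : Params) j) (rep (Mk (⟨d + 1, L, m, K, hd, hL⟩ : Params) j) t - rep (Mk (⟨d + 1, L, m, K, hd, hL⟩ : Params) j) t')) := torusDist_isPseudoDist (Mk (⟨d + 1, L, m, K, hd, hL⟩ : Params) j)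
  have b1 := blockBound_mono hρ ((GE (Domains.whole (P := (⟨d + 1, L, m, K, hd, hL⟩ : Params)) j (Nat.le_of_succ_le hj)) hc (w := fun _ => 1 * ((L : ℝ) ^ j) ^ (d + 1)) (fun _ => hw')) ∘ₗ LinearMap.adjoint (tsV1 hc Λ' w).Qv ∘ₗ ((tsV1 hc Λ' w).Δj + (1 * ((L : ℝ) ^ j) ^ (d + 1)) • (LinearMap.id : UBond (⟨d + 1, L, m, K, hd, hL⟩ : Params) j →ₗ[ℝ] UBond (⟨d + 1, L, m, K, hd, hL⟩ : Params) j)) ∘ₗ (tsV1 hc Λ' w).Qv) (fun b₀ : PBond (⟨d + 1, L, m, K, hd, hL⟩ : Params) 0 => iterBlockOf j b₀.src) (fun b₀ : PBond (⟨d + 1, L, m, K, hd, hL⟩ : Params) 0 => iterBlockOf j b₀.src) hC₁ le_rfl (min_le_left δ₁ δ₂) (h1 m K j hc hj Λ' w hw0 hw1 hw')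
  have b2 := blockBound_mono hρ ((tsV1 hc Λ' w).Hj ∘ₗ (tsV1 hc Λ' w).Ct ∘ₗ ((tsV1 hc Λ' w).Δj + (1 * ((L : ℝ) ^ j) ^ (d + 1)) • (LinearMap.id : UBond (⟨d + 1, L, m, K, hd, hL⟩ : Params) j →ₗ[ℝ] UBond (⟨d + 1, L, m, K, hd, hL⟩ : Params) j)) ∘ₗ (tsV1 hc Λ' w).Qv) (fun b₀ : PBond (⟨d + 1, L, m, K, hd, hL⟩ : Params) 0 => iterBlockOf j b₀.src) (fun b₀ : PBond (⟨d + 1, L, m, K, hd, hL⟩ : Params) 0 => iterBlockOf j b₀.src) hC₂ le_rfl (min_le_right δ₁ δ₂) (h2 m K j hc hj Λ' w hw0 hw1 hw')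
  have bid := blockBound_id hρ (fun b₀ : PBond (⟨d + 1, L, m, K, hd, hL⟩ : Params) 0 => iterBlockOf j b₀.src) (min δ₁ δ₂)
  have b3 := blockBound_sub (ρ := (fun t t' : Site (⟨d + 1, L, m, K, hd, hL⟩ : Params) j => torusSupNorm (Mk (⟨d + 1, L, m, K, hd, hL⟩ : Params) j) (rep (Mk (⟨d + 1, L, m, K, hd, hL⟩ : Params) j) t - rep (Mk (⟨d + 1, L, m, K, hd, hL⟩ : Params) j) t'))) _ _ (fun b₀ : PBond (⟨d + 1, L, m, K, hd, hL⟩ : Params) 0 => iterBlockOf j b₀.src) (fun b₀ : PBond (⟨d + 1, L, m, K, hd, hL⟩ : Params) 0 => iterBlockOf j b₀.src) bid b1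
  rw [adjoint_R0_eq hc hj Λ' hw hw']
  exact blockBound_add (ρ := (fun t t' : Site (⟨d + 1, L, m, K, hd, hL⟩ : Params) j => torusSupNorm (Mk (⟨d + 1, L, m, K, hd, hL⟩ : Params) j) (rep (Mk (⟨d + 1, L, m, K, hd, hL⟩ : Params) j) t - rep (Mk (⟨d + 1, L, m, K, hd, hL⟩ : Params) j) t'))) _ _ (fun b₀ : PBond (⟨d + 1, L, m, K, hd, hL⟩ : Params) 0 => iterBlockOf j b₀.src) (fun b₀ : PBond (⟨d + 1, L, m, K, hd, hL⟩ : Params) 0 => iterBlockOf j b₀.src) b3 b2 b₀ y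

open Classical in
/-- **THE `ℓ²`-BLOCK BOUND OF `R₀`, UNIFORMLY AT THE SCALING** (Schur on blocks, file 23): `∃ δ > 0, C ≥ 0` (on `d, L, a₀, a₁`) with
`|⟨v, R₀u⟩| ≤ C·e^{−δ|y − y′|_T}‖v‖‖u‖` for fine bond fields `v`, `u` over `B^j(y)`, `B^j(y′)`. [cite: Balaban1984PropagatorsII, Prop. 2.5 p.246; Balaban1984PropagatorsI, (1.114) p.36] -/
theorem l2blk_R0_scaling (d L : ℕ) (hd : 1 ≤ d + 1) (hL : Odd L ∧ 1 < L) {a₀ a₁ : ℝ} (ha₀ : 0 < a₀) (ha₁ : a₀ ≤ a₁) :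
    ∃ δ : ℝ, 0 < δ ∧ ∃ C : ℝ, 0 ≤ C ∧ ∀ (m K : ℕ) (j : ℕ) (hc : ((L : ℝ) ^ j) ≠ 0)
      (hj : j + 1 ≤ (⟨d + 1, L, m, K, hd, hL⟩ : Params).m + (⟨d + 1, L, m, K, hd, hL⟩ : Params).K)
      (Λ' : Finset (Site (⟨d + 1, L, m, K, hd, hL⟩ : Params) (j + 1))) (w : CIdx j Λ' → ℝ)
      (hw0 : ∀ i, a₀ * ((L : ℝ) ^ j) ^ (d + 1) ≤ w i) (hw1 : ∀ i, w i ≤ a₁ * ((L : ℝ) ^ j) ^ (d + 1))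
      (hw' : (0 : ℝ) < 1 * ((L : ℝ) ^ j) ^ (d + 1))
      (y y' : Site (⟨d + 1, L, m, K, hd, hL⟩ : Params) j) (v u : BondSpace (⟨d + 1, L, m, K, hd, hL⟩ : Params))
      (_hv : ∀ b : PBond (⟨d + 1, L, m, K, hd, hL⟩ : Params) 0, iterBlockOf j b.src ≠ y → v b = 0) (_hu : ∀ b : PBond (⟨d + 1, L, m, K, hd, hL⟩ : Params) 0, iterBlockOf j b.src ≠ y' → u b = 0),
      |⟪v, (((LinearMap.id - LinearMap.adjoint (tsV1 hc Λ' w).Qv ∘ₗ ((tsV1 hc Λ' w).Δj + (1 * ((L : ℝ) ^ j) ^ (d + 1)) • (LinearMap.id : UBond (⟨d + 1, L, m, K, hd, hL⟩ : Params) j →ₗ[ℝ] UBond (⟨d + 1, L, m, K, hd, hL⟩ : Params) j)) ∘ₗ (tsV1 hc Λ' w).Qv ∘ₗ (GE (Domains.whole (P := (⟨d + 1, L, m, K, hd, hL⟩ : Params)) j (Nat.le_of_succ_le hj)) hc (w := fun _ => 1 * ((L : ℝ) ^ j) ^ (d + 1)) (fun _ => hw')) + LinearMap.adjoint (tsV1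 hc Λ' w).Qv ∘ₗ ((tsV1 hc Λ' w).Δj + (1 * ((L : ℝ) ^ j) ^ (d + 1)) • (LinearMap.id : UBond (⟨d + 1, L, m, K, hd, hL⟩ : Params) j →ₗ[ℝ] UBond (⟨d + 1, L, m, K, hd, hL⟩ : Params) j)) ∘ₗ (tsV1 hc Λ' w).Ct ∘ₗ LinearMap.adjoint (tsV1 hc Λ' w).Hj : BondSpace (⟨d + 1, L, m, K, hd, hL⟩ : Params) →ₗ[ℝ] BondSpace (⟨d + 1, L, m, K, hd, hL⟩ : Params)))) u⟫_ℝ| ≤ C * Real.exp (-(δ * torusSupNorm (Mk (⟨d + 1, L, m, K, hd, hL⟩ : Params) j) (rep (Mk (⟨d + 1, L, m, K, hd, hL⟩ : Params) j) y - rep (Mk (⟨d + 1, L, m, K, hd, hL⟩ : Params) j) y'))) * (‖v‖ * ‖u‖) := by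
  obtain ⟨δ₁, hδ₁, C₁, hC₁, hrow⟩ := blockBound_R0_scaling d L hd hL ha₀ ha₁
  obtain ⟨δ₂, hδ₂, C₂, hC₂, hcol⟩ := blockBound_R0adj_scaling d L hd hL ha₀ ha₁
  refine ⟨min δ₁ δ₂, lt_min hδ₁ hδ₂, C₁ + C₂, by positivity, ?_⟩
  intro m K j hc hj Λ' w hw0 hw1 hw' y y' v u hv hu
  have hρ : IsPseudoDist (fun t t' : Site (⟨d + 1, L, m, K, hd, hL⟩ : Params) j => torusSupNorm (Mk (⟨d + 1, L, m, K, hd, hL⟩ : Params) j) (rep (Mk (⟨d + 1, L, m, K, hd, hL⟩ : Params) j) t - rep (Mk (⟨d + 1, L, m, K, hd, hL⟩ : Params) j) t')) := torusDist_isPseudoDist (Mk (⟨d + 1, L, m, K, hd, hL⟩ : Params) j)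
  have hf := blockBound_mono hρ (((LinearMap.id - LinearMap.adjoint (tsV1 hc Λ' w).Qv ∘ₗ ((tsV1 hc Λ' w).Δj + (1 * ((L : ℝ) ^ j) ^ (d + 1)) • (LinearMap.id : UBond (⟨d + 1, L, m, K, hd, hL⟩ : Params) j →ₗ[ℝ] UBond (⟨d + 1, L, m, K, hd, hL⟩ : Params) j)) ∘ₗ (tsV1 hc Λ' w).Qv ∘ₗ (GE (Domains.whole (P := (⟨d + 1, L, m, K, hd, hL⟩ : Params)) j (Nat.le_of_succ_le hj)) hc (w := fun _ => 1 * ((L : ℝ) ^ j) ^ (d + 1)) (fun _ => hw')) + LinearMap.adjoint (tsV1 hc Λ' w).Qv ∘ₗ ((tsV1 hc Λ' w).Δj + (1 * ((L : ℝ) ^ j) ^ (d + 1)) • (LinearMap.id : UBond (⟨d + 1, L, m, K, hd, hL⟩ : Params) j →ₗ[ℝ] UBond (⟨d + 1, L, m, K, hd, hL⟩ : Params) j)) ∘ₗ (tsV1 hc Λ' w).Ct ∘ₗ LinearMap.adjoint (tsV1 hc Λ' w).Hj : BondSpace (⟨d + 1, L, m, K, hd, hL⟩ : Params) →ₗ[ℝ]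 BondSpace (⟨d + 1, L, m, K, hd, hL⟩ : Params)))) (fun b₀ : PBond (⟨d + 1, L, m, K, hd, hL⟩ : Params) 0 => iterBlockOf j b₀.src) (fun b₀ : PBond (⟨d + 1, L, m, K, hd, hL⟩ : Params) 0 => iterBlockOf j b₀.src) hC₁ le_rfl (min_le_left δ₁ δ₂) (hrow m K j hc hj Λ' w hw0 hw1 hw')
  have hg := blockBound_mono hρ (LinearMap.adjoint (((LinearMap.id - LinearMap.adjoint (tsV1 hc Λ' w).Qv ∘ₗ ((tsV1 hc Λ' w).Δj + (1 * ((L : ℝ) ^ j) ^ (d + 1)) • (LinearMap.id : UBond (⟨d + 1, L, m, K, hd, hL⟩ : Params) j →ₗ[ℝ] UBond (⟨d + 1, L, m, K, hd, hL⟩ : Params) j)) ∘ₗ (tsV1 hc Λ' w).Qv ∘ₗ (GE (Domains.whole (P := (⟨d + 1, L, m, K, hd, hL⟩ : Params)) j (Nat.le_of_succ_le hj)) hc (w := fun _ => 1 * ((L : ℝ) ^ j) ^ (d + 1)) (fun _ => hw')) + LinearMap.adjoint (tsV1 hc Λ' w).Qv ∘ₗ ((tsV1 hc Λ' w).Δj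 + (1 * ((L : ℝ) ^ j) ^ (d + 1)) • (LinearMap.id : UBond (⟨d + 1, L, m, K, hd, hL⟩ : Params) j →ₗ[ℝ] UBond (⟨d + 1, L, m, K, hd, hL⟩ : Params) j)) ∘ₗ (tsV1 hc Λ' w).Ct ∘ₗ LinearMap.adjoint (tsV1 hc Λ' w).Hj : BondSpace (⟨d + 1, L, m, K, hd, hL⟩ : Params) →ₗ[ℝ] BondSpace (⟨d + 1, L, m, K, hd, hL⟩ : Params))))) (fun b₀ : PBond (⟨d + 1, L, m, K, hd, hL⟩ : Params) 0 => iterBlockOf j b₀.src) (fun b₀ : PBond (⟨d + 1, L, m, K, hd, hL⟩ : Params) 0 => iterBlockOf j b₀.src) hC₂ le_rfl (min_le_right δ₁ δ₂) (hcol m K j hc hj Λ' w hw0 hw1 hw')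
  exact l2blk_of_blockBounds hρ (((LinearMap.id - LinearMap.adjoint (tsV1 hc Λ' w).Qv ∘ₗ ((tsV1 hc Λ' w).Δj + (1 * ((L : ℝ) ^ j) ^ (d + 1)) • (LinearMap.id : UBond (⟨d + 1, L, m, K, hd, hL⟩ : Params) j →ₗ[ℝ] UBond (⟨d + 1, L, m, K, hd, hL⟩ : Params) j)) ∘ₗ (tsV1 hc Λ' w).Qv ∘ₗ (GE (Domains.whole (P := (⟨d + 1, L, m, K, hd, hL⟩ : Params)) j (Nat.le_of_succ_le hj)) hc (w := fun _ => 1 * ((L : ℝ) ^ j) ^ (d + 1)) (fun _ => hw')) + LinearMap.adjoint (tsV1 hc Λ' w).Qv ∘ₗ ((tsV1 hc Λ' w).Δj + (1 * ((L : ℝ) ^ j) ^ (d + 1)) • (LinearMap.id : UBond (⟨d + 1, L, m, K, hd, hL⟩ : Params) j →ₗ[ℝ] UBond (⟨d + 1, L, m, K, hd, hL⟩ : Params) j)) ∘ₗ (tsV1 hc Λ' w).Ct ∘ₗ LinearMap.adjoint (tsV1 hc Λ' w).Hj : BondSpace (⟨d + 1, L, m, K, hd, hL⟩ : Params) →ₗ[ℝ]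 BondSpace (⟨d + 1, L, m, K, hd, hL⟩ : Params)))) (fun b₀ : PBond (⟨d + 1, L, m, K, hd, hL⟩ : Params) 0 => iterBlockOf j b₀.src) (fun b₀ : PBond (⟨d + 1, L, m, K, hd, hL⟩ : Params) 0 => iterBlockOf j b₀.src) hC₁ hC₂ (by positivity) (by nlinarith) hf hg y y' v u hv hu

open Classical in
/-- **`M = G̃_j + H_jC̃H_j*` HAS A UNIFORM ROW BLOCK BOUND** (files 6 and 5). [cite: Balaban1984PropagatorsII, (2.129) p.246] -/
theorem blockBound_M_scaling (d L : ℕ) (hd : 1 ≤ d + 1) (hL : Odd L ∧ 1 < L) {a₀ a₁ : ℝ} (ha₀ : 0 < a₀) (ha₁ : a₀ ≤ a₁) :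
    ∃ δ : ℝ, 0 < δ ∧ ∃ C : ℝ, 0 ≤ C ∧ ∀ (m K : ℕ) (j : ℕ) (hc : ((L : ℝ) ^ j) ≠ 0)
      (hj : j + 1 ≤ (⟨d + 1, L, m, K, hd, hL⟩ : Params).m + (⟨d + 1, L, m, K, hd, hL⟩ : Params).K)
      (Λ' : Finset (Site (⟨d + 1, L, m, K, hd, hL⟩ : Params) (j + 1))) (w : CIdx j Λ' → ℝ)
      (_hw0 : ∀ i, a₀ * ((L : ℝ) ^ j) ^ (d + 1) ≤ w i) (_hw1 : ∀ i, w i ≤ a₁ * ((L : ℝ) ^ j) ^ (d + 1))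
      (b₀ : PBond (⟨d + 1, L, m, K, hd, hL⟩ : Params) 0) (y : Site (⟨d + 1, L, m, K, hd, hL⟩ : Params) j),
      ∑ b₀' ∈ univ.filter (fun b₀' : PBond (⟨d + 1, L, m, K, hd, hL⟩ : Params) 0 => iterBlockOf j b₀'.src = y),
          |((tsV1 hc Λ' w).Gt + (tsV1 hc Λ' w).Hj ∘ₗ (tsV1 hc Λ' w).Ct ∘ₗ LinearMap.adjoint (tsV1 hc Λ' w).Hj) (EuclideanSpace.single b₀' (1 : ℝ)) b₀| ≤
        C * Real.exp (-(δ * torusSupNorm (Mk (⟨d + 1, L, m, K, hd, hL⟩ : Params) j) (rep (Mk (⟨d + 1, L, m, K, hd, hL⟩ : Params) j) (iterBlockOf j b₀.src) - rep (Mk (⟨d + 1, L, m, K, hd, hL⟩ : Params) j) y))) := by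
  obtain ⟨δ₄, hδ₄, C₄, hC₄, hHCH⟩ := blockBound_HjCtHj_scaling d L hd hL ha₀ ha₁
  obtain ⟨δ₅, hδ₅, C₅, hC₅, hGt⟩ := blockBound_Gt_scaling d L hd hL
  refine ⟨min δ₅ δ₄, lt_min hδ₅ hδ₄, C₅ + C₄, by positivity, ?_⟩
  intro m K j hc hj Λ' w hw0 hw1 b₀ y
  have hL0 : 0 < L := by have := hL.2; omega
  have hLp : (0 : ℝ) < L := by exact_mod_cast hL0
  have hw : ∀ i, 0 < w i := fun i => lt_of_lt_of_le (by positivity) (hw0 i)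
  have hρ : IsPseudoDist (fun t t' : Site (⟨d + 1, L, m, K, hd, hL⟩ : Params) j => torusSupNorm (Mk (⟨d + 1, L, m, K, hd, hL⟩ : Params) j) (rep (Mk (⟨d + 1, L, m, K, hd, hL⟩ : Params) j) t - rep (Mk (⟨d + 1, L, m, K, hd, hL⟩ : Params) j) t')) := torusDist_isPseudoDist (Mk (⟨d + 1, L, m, K, hd, hL⟩ : Params) j)
  have b5 := blockBound_mono hρ (tsV1 hc Λ' w).Gt (fun b₀ : PBond (⟨d + 1, L, m, K, hd, hL⟩ : Params) 0 => iterBlockOf j b₀.src) (fun b₀ : PBond (⟨d + 1, L, m, K, hd, hL⟩ : Params) 0 => iterBlockOf j b₀.src) hC₅ le_rfl (min_le_left δ₅ δ₄) (hGt m K j hc hj Λ' w hw)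
  have b4 := blockBound_mono hρ ((tsV1 hc Λ' w).Hj ∘ₗ (tsV1 hc Λ' w).Ct ∘ₗ LinearMap.adjoint (tsV1 hc Λ' w).Hj) (fun b₀ : PBond (⟨d + 1, L, m, K, hd, hL⟩ : Params) 0 => iterBlockOf j b₀.src) (fun b₀ : PBond (⟨d + 1, L, m, K, hd, hL⟩ : Params) 0 => iterBlockOf j b₀.src) hC₄ le_rfl (min_le_right δ₅ δ₄) (hHCH m K j hc hj Λ' w hw0 hw1)
  exact blockBound_add (ρ := (fun t t' : Site (⟨d + 1, L, m, K, hd, hL⟩ : Params) j => torusSupNorm (Mk (⟨d + 1, L, m, K, hd, hL⟩ : Params) j) (rep (Mk (⟨d + 1, L, m, K, hd, hL⟩ : Params) j) t - rep (Mk (⟨d + 1, L, m, K, hd, hL⟩ : Params) j) t'))) _ _ (fun b₀ : PBond (⟨d + 1, L, m, K, hd, hL⟩ : Params) 0 => iterBlockOf j b₀.src) (fun b₀ : PBond (⟨d + 1, L, m, K, hd, hL⟩ : Params) 0 => iterBlockOf j b₀.src) b5 b4 b₀ y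

open Classical in
/-- **THE `ℓ²`-BLOCK BOUND OF `M = G̃_j + H_jC̃H_j*`, UNIFORMLY** (`M* = M`: rows = columns; Schur on blocks, file 23).
[cite: Balaban1984PropagatorsII, Prop. 2.5 p.246; Balaban1984PropagatorsI, (1.114) p.36] -/
theorem l2blk_M_scaling (d L : ℕ) (hd : 1 ≤ d + 1) (hL : Odd L ∧ 1 < L) {a₀ a₁ : ℝ} (ha₀ : 0 < a₀) (ha₁ : a₀ ≤ a₁) :
    ∃ δ : ℝ, 0 < δ ∧ ∃ C : ℝ, 0 ≤ C ∧ ∀ (m K : ℕ) (j : ℕ) (hc : ((L : ℝ) ^ j) ≠ 0)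
      (hj : j + 1 ≤ (⟨d + 1, L, m, K, hd, hL⟩ : Params).m + (⟨d + 1, L, m, K, hd, hL⟩ : Params).K)
      (Λ' : Finset (Site (⟨d + 1, L, m, K, hd, hL⟩ : Params) (j + 1))) (w : CIdx j Λ' → ℝ)
      (_hw0 : ∀ i, a₀ * ((L : ℝ) ^ j) ^ (d + 1) ≤ w i) (_hw1 : ∀ i, w i ≤ a₁ * ((L : ℝ) ^ j) ^ (d + 1))
      (y y' : Site (⟨d + 1, L, m, K, hd, hL⟩ : Params) j) (v u : BondSpace (⟨d + 1, L, m, K, hd, hL⟩ : Params))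
      (_hv : ∀ b : PBond (⟨d + 1, L, m, K, hd, hL⟩ : Params) 0, iterBlockOf j b.src ≠ y → v b = 0) (_hu : ∀ b : PBond (⟨d + 1, L, m, K, hd, hL⟩ : Params) 0, iterBlockOf j b.src ≠ y' → u b = 0),
      |⟪v, ((tsV1 hc Λ' w).Gt + (tsV1 hc Λ' w).Hj ∘ₗ (tsV1 hc Λ' w).Ct ∘ₗ LinearMap.adjoint (tsV1 hc Λ' w).Hj) u⟫_ℝ| ≤ C * Real.exp (-(δ * torusSupNorm (Mk (⟨d + 1, L, m, K, hd, hL⟩ : Params) j) (rep (Mk (⟨d + 1, L, m, K, hd, hL⟩ : Params) j) y - rep (Mk (⟨d + 1, L, m, K, hd, hL⟩ : Params) j) y'))) * (‖v‖ * ‖u‖) := by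
  obtain ⟨δ₁, hδ₁, C₁, hC₁, hrow⟩ := blockBound_M_scaling d L hd hL ha₀ ha₁
  refine ⟨δ₁, hδ₁, C₁ + C₁, by positivity, ?_⟩
  intro m K j hc hj Λ' w hw0 hw1 y y' v u hv hu
  have hL0 : 0 < L := by have := hL.2; omega
  have hLp : (0 : ℝ) < L := by exact_mod_cast hL0
  have hw : ∀ i, 0 < w i := fun i => lt_of_lt_of_le (by positivity) (hw0 i)
  have hρ : IsPseudoDist (fun t t' : Site (⟨d + 1, L, m, K, hd, hL⟩ : Params) j => torusSupNorm (Mk (⟨d + 1, L, m, K, hd, hL⟩ : Params) j) (rep (Mk (⟨d + 1, L, m, K, hd, hL⟩ : Params) j) t - rep (Mk (⟨d + 1, L, m, K, hd, hL⟩ : Params) j) t')) := torusDist_isPseudoDist (Mk (⟨d + 1, L, m, K, hd, hL⟩ : Params) j)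
  have hf := hrow m K j hc hj Λ' w hw0 hw1
  have hg : ∀ (b₀ : PBond (⟨d + 1, L, m, K, hd, hL⟩ : Params) 0) (y : Site (⟨d + 1, L, m, K, hd, hL⟩ : Params) j),
      ∑ b₀' ∈ univ.filter (fun b₀' : PBond (⟨d + 1, L, m, K, hd, hL⟩ : Params) 0 => iterBlockOf j b₀'.src = y),
          |LinearMap.adjoint ((tsV1 hc Λ' w).Gt + (tsV1 hc Λ' w).Hj ∘ₗ (tsV1 hc Λ' w).Ct ∘ₗ LinearMap.adjoint (tsV1 hc Λ' w).Hj) (EuclideanSpace.single b₀' (1 : ℝ)) b₀| ≤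
        C₁ * Real.exp (-(δ₁ * torusSupNorm (Mk (⟨d + 1, L, m, K, hd, hL⟩ : Params) j) (rep (Mk (⟨d + 1, L, m, K, hd, hL⟩ : Params) j) (iterBlockOf j b₀.src) - rep (Mk (⟨d + 1, L, m, K, hd, hL⟩ : Params) j) y))) := by
    rw [adjoint_M_V1 hc hj Λ' hw]
    exact hf
  exact l2blk_of_blockBounds hρ ((tsV1 hc Λ' w).Gt + (tsV1 hc Λ' w).Hj ∘ₗ (tsV1 hc Λ' w).Ct ∘ₗ LinearMap.adjoint (tsV1 hc Λ' w).Hj) (fun b₀ : PBond (⟨d + 1, L, m, K, hd, hL⟩ : Params) 0 => iterBlockOf j b₀.src) (fun b₀ : PBond (⟨d + 1, L, m, K, hd, hL⟩ : Params) 0 => iterBlockOf j b₀.src) hC₁ hC₁ (by positivity) (by nlinarith) hf hg y y' v u hv hu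

open Classical in
/-- **THE `ℓ²`-BLOCK BOUND OF `K₂`, UNIFORMLY** (rows and columns from file 3; Schur on blocks, file 23).
[cite: Balaban1984PropagatorsII, Prop. 2.5 p.246; Balaban1984PropagatorsI, (1.114) p.36] -/
theorem l2blk_K2_scaling (d L : ℕ) (hd : 1 ≤ d + 1) (hL : Odd L ∧ 1 < L) :
    ∃ δ : ℝ, 0 < δ ∧ ∃ C : ℝ, 0 ≤ C ∧ ∀ (m K : ℕ) (j : ℕ) (hc : ((L : ℝ) ^ j) ≠ 0)
      (hj : j + 1 ≤ (⟨d + 1, L, m, K, hd, hL⟩ : Params).m + (⟨d + 1, L, m, K, hd, hL⟩ : Params).K)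
      (Λ' : Finset (Site (⟨d + 1, L, m, K, hd, hL⟩ : Params) (j + 1))) (w : CIdx j Λ' → ℝ) (_hw : ∀ i, 0 < w i)
      (y y' : Site (⟨d + 1, L, m, K, hd, hL⟩ : Params) j) (v u : BondSpace (⟨d + 1, L, m, K, hd, hL⟩ : Params))
      (_hv : ∀ b : PBond (⟨d + 1, L, m, K, hd, hL⟩ : Params) 0, iterBlockOf j b.src ≠ y → v b = 0) (_hu : ∀ b : PBond (⟨d + 1, L, m, K, hd, hL⟩ : Params) 0, iterBlockOf j b.src ≠ y' → u b = 0),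
      |⟪v, (tsV1 hc Λ' w).K2 u⟫_ℝ| ≤ C * Real.exp (-(δ * torusSupNorm (Mk (⟨d + 1, L, m, K, hd, hL⟩ : Params) j) (rep (Mk (⟨d + 1, L, m, K, hd, hL⟩ : Params) j) y - rep (Mk (⟨d + 1, L, m, K, hd, hL⟩ : Params) j) y'))) * (‖v‖ * ‖u‖) := by
  obtain ⟨δ₁, hδ₁, C₁, hC₁, hrow⟩ := blockBound_K2_scaling d L hd hL
  obtain ⟨δ₂, hδ₂, C₂, hC₂, hcol⟩ := blockBound_K2adj_scaling d L hd hL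
  refine ⟨min δ₁ δ₂, lt_min hδ₁ hδ₂, C₁ + C₂, by positivity, ?_⟩
  intro m K j hc hj Λ' w hw y y' v u hv hu
  have hρ : IsPseudoDist (fun t t' : Site (⟨d + 1, L, m, K, hd, hL⟩ : Params) j => torusSupNorm (Mk (⟨d + 1, L, m, K, hd, hL⟩ : Params) j) (rep (Mk (⟨d + 1, L, m, K, hd, hL⟩ : Params) j) t - rep (Mk (⟨d + 1, L, m, K, hd, hL⟩ : Params) j) t')) := torusDist_isPseudoDist (Mk (⟨d + 1, L, m, K, hd, hL⟩ : Params) j)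
  have hf := blockBound_mono hρ (tsV1 hc Λ' w).K2 (fun b₀ : PBond (⟨d + 1, L, m, K, hd, hL⟩ : Params) 0 => iterBlockOf j b₀.src) (fun b₀ : PBond (⟨d + 1, L, m, K, hd, hL⟩ : Params) 0 => iterBlockOf j b₀.src) hC₁ le_rfl (min_le_left δ₁ δ₂) (hrow m K j hc hj Λ' w hw)
  have hg := blockBound_mono hρ (LinearMap.adjoint (tsV1 hc Λ' w).K2) (fun b₀ : PBond (⟨d + 1, L, m, K, hd, hL⟩ : Params) 0 => iterBlockOf j b₀.src) (fun b₀ : PBond (⟨d + 1, L, m, K, hd, hL⟩ : Params) 0 => iterBlockOf j b₀.src) hC₂ le_rfl (min_le_right δ₁ δ₂) (hcol m K j hc hj Λ' w hw)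
  exact l2blk_of_blockBounds hρ (tsV1 hc Λ' w).K2 (fun b₀ : PBond (⟨d + 1, L, m, K, hd, hL⟩ : Params) 0 => iterBlockOf j b₀.src) (fun b₀ : PBond (⟨d + 1, L, m, K, hd, hL⟩ : Params) 0 => iterBlockOf j b₀.src) hC₁ hC₂ (by positivity) (by nlinarith) hf hg y y' v u hv hu

end L2

end Literature.MathematicalPhysics.QuantumFieldTheory.Balaban1983to89.B6L2BlockSmoothTermsV1

end
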